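import Literature.MathematicalPhysics.QuantumFieldTheory.BalabanImbrieJaffe1984to88.BIJ88Close231RegularTorusCwt
import Literature.MathematicalPhysics.QuantumFieldTheory.BalabanImbrieJaffe1984to88.BIJ88LocDeriv230ZetaPiFlatTorus

/-!
# `BalabanImbrieJaffe1984to88.BIJ88Close231RegularRegionCwt` — T. Bałaban, J. Imbrie, A. Jaffe, *Effective action and cluster properties of
the abelian Higgs model*, Commun. Math. Phys. **114** (1988) 257–315 [BalabanImbrieJaffe1988], Sect. 2 p. 263 [PDF 7], (2.27)–(2.29), (2.31),
(2.35): **(2.31) (OPERATOR, KERNEL AND COVARIANT-DERIVATIVE FORMS) AND (2.35) FOR A GENERAL REGION `Ω ⊂ T_η` AT A NON-FLAT BACKGROUND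
`u = e^{ieεA}` WITH `A` (2.23)-REGULAR ON `Ω` ONLY, FOR THE PRINTED LOCALIZATION DATA WITH BIG-BLOCK CUBES** — print: *"(2.31) for
dist(x, Ω^c) ≧ O(r(e_k)) … for (2.31) we assume smoothness throughout the subset Ω ⊂ T_η"*.  This seat's gen-23/24 members
(`BIJ88Close231RegularTorusCwt.opClose231_regular_torus_cwt` / `close231_regular_torus_kernel_cwt` / `close235_regular_torus_cwt` /
`deriv231_regular_torus_cwt`) and gen 25's `deriv231_regular_of_lipschitz` are the case `Ω = T_η` with `A` regular on the whole torus (their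
HONEST SCOPE (i)/(ii)); here `Ω` is ANY union of big blocks (side `L^kL^s`) containing the big-block hull of the reference box `Ω₀` of the
localization data, and the regularity of `A` is assumed on `Ω` alone — the two restrictions are removed, for the value members and the
order-`1` member.

statement-level skeleton of published theorems with citation tags; proofs where landed; nothing here is a claim about the Yang–Mills mass gap

PDF held: `paper:balaban1988-cmp114-bij-abelian-higgs-effective-action` (journal page = PDF page + 256); p. 263 [PDF 7] re-read this session on the
materialised text layer; [6] = [Balaban1983RegularityDecay] Theorem p. 573 (1.10), (1.11)–(1.12) through r01's `BIJ85NeumannPropagatorRegularClose`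
(`input110_regular_deep`, `input112_regular_deep`) and `BIJ85NeumannPropagatorRegularDeriv` (`input110_deriv_regular_deep`,
`input112_deriv_regular_deep`) — all four stated for big-block regions `B ⊆ X` with the regularity of `A` assumed ON `X` ONLY.

CITATION HEADER (lean-in-tree rule).  lit-balaban cell (HOME `run/shared/lean/pub/lit-balaban/`), Phase 2, seat r18 gen 25 (unit `lit-balaban-r18`,
literature-prover-lit-balaban-r18-g25-0; C2 §§1–4 fold owner), free-target protocol G.5-34(d), TAKING #3 line HOME/STATUS.md 2026-08-23T06:39:04Z
(window → 06:59Z; cc p31 g22 — his `_gen` chain and his gen-20 `BIJ88Decay236RegularRegion` = (2.36) for the region form at regular `u` — and r01).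
Rows of `HOME/lit-balaban-r18/ROWS-C2.md` served (LOCATED MEMBERS, cells only; heads unchanged): **C2.Eq2.31** p. 263 (head p02's
`BIJ88OpClose231Proof`), **C2.Eq2.35** (head p02's `BIJ88DeltaLocClose235`).  Kind: theorems only (no definition, no `Prop`-valued fact).  Files
USED BY NAME, nothing restated: p31 v1.1 `BIJ88DeltaLocClose235General` (**`opClose231_gen`**, **`close231_kernel_gen`**, **`close235_gen`** — the
row-restricted chain with a general `Ω` and row set `X₀`), r01 g26 `BIJ85NeumannPropagatorRegularClose` (**`input110_regular_deep`**,
**`input112_regular_deep`**), `BIJ85NeumannPropagatorRegularDeriv` (**`input110_deriv_regular_deep`**, **`input112_deriv_regular_deep`**), r18 g24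
`BIJ88Close231RegularTorusCwt` (`bbHull`, `mem_bbHull`, `subset_bbHull`, `bbHull_bigBlock`, `cubeFamB`, `deepRows`, `mem_deepRows`, `rowMargin`,
`rowHyp_ii_hull`), p29 g26 `BIJ88LocWeights227Torus` (`labels`, `lamFam`, `cubeOf_subset`, `activeLabels`, `rowHyp_i`, `rowHyp_iii`,
`cutoff_eq_zero_of_le`, `cutoff_mem_unitInterval`, `mem_activeLabels_of_ne_zero_of_deep`, `card_subtype_activeLabels_le`, `mem_and_abs_sub_le_of_T_le`,
`mem_and_depth_of_mem_blockK`, `sum_abs_lamT_le_one`), p29 g27 `BIJ88LocDeriv231FlatTorus` (`covD_gLocT_sub_apply`), `BIJ88LocDeriv230FlatTorus`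
(`T_shift_le_one`, `abs_T_shift_sub_le`), `BIJ88LocDeriv230ZetaPiFlatTorus` (`norm_rowSource_sub_le_of_lipschitz`), p13's cut-off
`BIJ88Cutoffs21.cutoff`, p31 (`gBox`, `gLocT`, `deltaLocT`, `deltaRegion`, `cubeT`, `boxCoord`, `norm_rowSource_le`, `rowSource_ne_zero`,
`abs_lam_le_one`), p38's metric `B5Ineq137Torus.T`, r18's `BIJ88Sect3Statements.covD`/`cfg`; the four tail kernels `norm_tail_le'`,
`norm_tailDiff_le'`, `T_gt_of_tail_ne_zero'`, `T_gt_of_tailDiff_ne_zero'` are PRIVATE COPIES of r18 g25's public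
`BIJ88LocDerivHolder231RegularTorus` §1 (statements of record there; copied privately so that this value/order-1 file does not import the 2165-line
order-(1+θ) file).

THE PRINTED TEXT (verbatim, p. 263).  *"|(G_{k,loc}(u)f − G_k(Ω,u)f)(x)| ≦ e^{−cr(e_k)}e^{−c dist(suppt f,x)}‖f‖_∞, (2.31) for dist(x, Ω^c) ≧
O(r(e_k)). [Each G_k(□_α, u) is close to G_k(Ω, u) for the relevant x₁, x₂, therefore the convex combination and G_{k,loc} are close also.] … for
(2.31) we assume smoothness throughout the subset Ω ⊂ T_η … |Δ_{k,loc}(u; x₁, x₂) − Δ_k(Ω, u; x₁, x₂)| ≦ e^{−cr(e_k)}e^{−c|x₁−x₂|} (2.35) for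
dist({x₁, x₂}, Ω^c) > O(r(e_k))."*  *"Smooth"* `u` ON `Ω` is taken in the (2.23)-regular form of [BalabanImbrieJaffe1985] p. 326 / [6]: `u = e^{ieεA}`
with `L^kε|e|/e_k·|∂A|(z) ≦ c·e_k^{β−1}/L^k` FOR `z ∈ Ω`, `0 < e_k ≦ e₁`.

WHAT IS PROVED (theorems only; 0 `sorry`; standard axioms).
* §1 `bbHull_mono`; **`cubeFamB_subset_of_hull_subset`**: `bbHull b Ω₀ ⊆ Ω ⟹ □̃_α ⊆ Ω` for every label (the cubes are sub-boxes of `Ω₀`).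
* §2 **`inputs_regular_region`** — for a big-block region `Ω` and `A` regular ON `Ω`: the (H1.10″) value member for `G_k(Ω,u)` at the
  `rowMargin`-deep rows of `Ω` and the (H1.12″) value member for every big-block `B ⊆ Ω` against `Ω` at the deep rows of `B` (depths to `T ∖ B`),
  at ONE set of constants `(c₀, e₁)`, rate `δ₀ = 1/(8L^s)` (r01's two members BY NAME, `c₀ = max`, `e₁ = min`, rate `1/(4L^s)` weakened).
* §3 `mem_deepRows_of_depth` (a point of `Ω₀` at chart depth `≥ ρ` is a `ρ`-deep row of every region containing `Ω₀`);
  **`opClose231_regular_region_cwt`** — `∃ s₀ ∀ s ≥ s₀ ∃ c₀ e₁ > 0` (from `(d, L, a, e, c, β, s)`): on every torus of the series (`P.d = d+1`,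
  `P.L = L ≥ 2`), every level `1 ≤ k ≤ K`, `k + s ≤ m + K`, `3L^kL^s ≤ |T^{(0)}|`, EVERY big-block region `Ω`, every `A` regular on `Ω` (`0 < e_k ≤ e₁`),
  every reference box `Ω₀` (torus gap `≥ R`) with `bbHull (L^kL^s) Ω₀ ⊆ Ω`, `s_g ≥ 1`, `W ≥ 2s_g/3 + R₀/2 + R`, `R > rowMargin`, `0 ≤ R₁ < R₀`, every
  row `x ∈ Ω₀` of chart depth `≥ R₀ + R`, every `f` (`‖f‖_∞ ≤ F`) supported at distance `≥ D ≥ 0` from `x`: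
  `‖(G_{k,loc}(u)f)(x) − (G_k(Ω,u)f)(x)‖ ≤ (L^kε)²·c₀·(m·e^{−2δ₀R/L^k} + e^{−(δ₀/2)R₁/L^k})·e^{−(δ₀/2)D/L^k}·F`, `m = (⌊(L^k−1+R₀)/s_g⌋+3)^{d+1}`;
  **`close231_regular_region_kernel_cwt`** (every `y`: `≤ (L^kε)²c₀(e^{−2δ₀R/L^k} + e^{−(δ₀/2)R₁/L^k})e^{−(δ₀/2)|x−y|_T/L^k}`);
  **`close235_regular_region_cwt`** (`‖Δ_{k,loc}(u;y₁,y₂) − Δ_k(Ω,u;y₁,y₂)‖ ≤ A·a_k·c₀e^{δ₀/2}(m·e^{−2δ₀R/L^k} + e^{−(δ₀/2)R₁/L^k})e^{−(δ₀/2)|y₁−y₂|}`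
  for every block `B^k(y₁)` in `Ω₀` at chart margin `R₀ + R`); `opClose231_regular_region_cwt_univ` (the case `Ω = T^{(0)}` = gen 24's statement,
  recovered).  MECHANISM: p31's `_gen` chain with `X₀ = deepRows rowMargin Ω` (contains `x`, resp. the block of `y₁`, by §3's depth lemma), the
  inputs of §2 (every hull `□̃_α ⊆ Ω` by §1), the row facts (i) `rowHyp_i`, (ii) `rowHyp_ii_hull`, (iii) `rowHyp_iii` — gen 24's proofs verbatim
  with `T^{(0)} ↦ Ω`.
* §4 **`deriv231_regular_region_of_lipschitz`** — the covariant-derivative analogue of (2.31) for the region `Ω`, generic Lipschitz cut-off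
  (`|ζ″| ≤ 1`, `ζ″ = 0` beyond `R₀`, `= 1` within `R₁`, one-step modulus `K₁/(R₀−R₁)`), `R > rowMargin + 1`, bonds with both endpoints at chart depth
  `≥ R₀ + R`: `‖D_u(G_{k,loc}(u)f)(⟨x,μ⟩) − D_u(G_k(Ω,u)f)(⟨x,μ⟩)‖ ≤ (L^kε)·c₀·[m(1 + L^k((R₀−R₁)⁻¹ + s_g⁻¹))e^{−δ₀(2R−1)/L^k} +
  (1 + L^k(R₀−R₁)⁻¹)e^{−(δ₀/2)(R₁−1)/L^k}]·e^{−(δ₀/2)D/L^k}·F` — gen 25's `deriv231_regular_of_lipschitz` verbatim with `T^{(0)} ↦ Ω` (r01's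
  `input112_deriv_regular_deep` with `□̃_α ⊆ Ω`, `input110_deriv_regular_deep` on `Ω` at the row `x`, §2's value members).
* §5 (v1.1) **`opClose231_regular_region_cwt_nonvacuous`** — the hypotheses of §3 are JOINTLY SATISFIABLE WITH A PROPER REGION, thresholds
  included: for every `(a, e, c, β)` there are `s` (the threshold itself), `c₀, e₁ > 0` and — chosen after them — the `Setup` torus `ℤ/(2·3^{s+7})`
  (`d = 1`, `L = 3`, `m = s + 6`, `K = 1`), `k = 1`, `Ω₀ = [0, 3^{s+5})`, `Ω = bbHull (3·3^s) Ω₀` (a union of big blocks that MISSES the site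
  `3^{s+5}`, so `Ω ≠ T^{(0)}`), `A = 0`, `s_g = 1`, `R = rowMargin + 1`, `R₀ = 1`, `R₁ = 0`, `W = rowMargin + 3`, `x ≡ rowMargin + 2`, meeting every
  displayed hypothesis; consequently the (2.31) bound against `G_k(Ω,u)` holds there for every `f` (gen 24's `opClose231_regular_torus_cwt_nonvacuous`
  with `T^{(0)} ↦ Ω`).
* §6 (v1.1) **`opClose231_regular_region_cwt_gaugeOrbit`** — §3's operator bound VERBATIM at every gauge transform `u = (e^{ieεA})^h` of a
  background regular on `Ω` (p31's `gLocT_gaugeAct` / `gBox_gaugeAct`; a union of big blocks is a union of `k`-blocks, r01's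
  `isBlockUnion_of_bigBlocks`; `|h| = 1`) — gen 24's `opClose231_regular_torus_cwt_gaugeOrbit` with `T^{(0)} ↦ Ω`.
HONEST SCOPE / DIVERGENCE.  (i) `Ω` must be a union of big blocks of side `L^kL^s` (r01's region hypothesis) CONTAINING `bbHull (L^kL^s) Ω₀` —
print's *"dist(x, Ω^c) ≧ O(r(e_k))"* is rendered by reading the localization in a reference chart box `Ω₀ ∋ x` whose big-block hull lies in `Ω`
(the tree's `G_{k,loc}` is the `Ω₀`-relative object of p29/p31's torus data; at rows `x ∈ Ω₀` of chart depth `≥ R₀ + R` the (2.27) sum is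
complete); `u = e^{ieεA}` with `A` regular on `Ω`, or (§6, operator form) any gauge transform of it.  (ii) The cubes are the
big-block hulls `cubeFamB`; deep bonds only; constants existential (r01's thresholds), `δ₀ = 1/(8L^s)` explicit.  (iii) The cut-off of §3 is
p13's `cutoff R₁ R₀ |·|_T` of record; §4 is for a generic Lipschitz cut-off (instances: p13's, or r18's `ζ^Π` via `abs_zetaPi_zero_shift_sub_le`).
(iv) Not here: the Hölder members for a general `Ω` (order `θ ≤ 1`: p29's pattern; order `1 + θ`: gen 25's eight-term split with `T^{(0)} ↦ Ω`, whose
(1.9)/(1.12) Hölder inputs r01 states for regions already) and (2.36)/(2.38)–(2.41), which do not involve `Ω` (gen 24 / p31) — p31 gen 20's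
`decay236_region_regular` is the (2.36) member for `Δ_k(Ω,u)`.  Imports: r18 g24 `BIJ88Close231RegularTorusCwt`, p29 `BIJ88LocDeriv230ZetaPiFlatTorus`.
Literature + Mathlib only.  Unit `lit-balaban-r18` (literature-prover-lit-balaban-r18-g25-0), 2026-08-23; v1.1 (same day) = v1 (p356334) VERBATIM + §5, §6.  NOT summit progress.
-/

open scoped BigOperators Matrix ComplexConjugate
open Finset Matrix

namespace Literature.MathematicalPhysics.QuantumFieldTheory.BalabanImbrieJaffe1984to88.BIJ88Close231RegularRegionCwt

open Literature.MathematicalPhysics.QuantumFieldTheory.Balaban1983to89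
open BIJ88Sect3Statements (U1)
open BIJ85BlockAveragesTorus BIJ85BlockAveragesTorusK
open BIJ88NeumannPropagator227Torus (gBox)
open BIJ88DeltaLoc234Torus (gLocT deltaLocT deltaRegion)
open BIJ88NeumannPropagatorFlatDecayCube (cubeT boxCoord)
open BIJ88Cutoffs21 (cutoff)
open BIJ88LocWeights227Torus
open BIJ85CovariantHiggsDictionary (expGauge)
open BIJ88DeltaLocClose235General (opClose231_gen close231_kernel_gen close235_gen)
open BIJ85NeumannPropagatorRegularClose (input110_regular_deep input112_regular_deep)
open BIJ88Close231RegularTorusCwt (bbHull mem_bbHull subset_bbHull bbHull_bigBlock cubeFamB deepRows mem_deepRows rowMargin rowHyp_ii_hull)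

noncomputable section

variable {P : Params}

/-! ## §1 Kernel: monotonicity of the big-block hull; the hulls of the (2.27) cubes lie in every region containing the hull of `Ω₀` -/

section Hull

variable {d : ℕ} (hPd : P.d = d + 1)

/-- **The big-block hull is monotone**: `X ⊆ Y ⟹ bbHull b X ⊆ bbHull b Y`. [cite: BalabanImbrieJaffe1988, (2.27) p.263] -/
theorem bbHull_mono (b : ℕ) {X Y : Finset (Balaban1983to89.Site P 0)} (h : X ⊆ Y) : bbHull b X ⊆ bbHull b Y := by
  intro z hz
  obtain ⟨y, hy, hzy⟩ := mem_bbHull.1 hz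
  exact mem_bbHull.2 ⟨y, h hy, hzy⟩

/-- **Every big-block cube `□̃_α` of the printed family lies in any region containing the big-block hull of the reference box `Ω₀`** (the cubes
`□_α` of (2.27) are sub-boxes of `Ω₀`: p29's `cubeOf_subset`). [cite: BalabanImbrieJaffe1988, (2.27) p.263] -/
theorem cubeFamB_subset_of_hull_subset {n : ℕ} {c M0 : Fin (d + 1) → ℕ} {s W b : ℕ} {Ω : Finset (Balaban1983to89.Site P 0)}
    (hΩ₀ : bbHull b (cubeT hPd n c fun i => n * M0 i) ⊆ Ω) (α : ↥(labels n M0 s)) : cubeFamB hPd n c M0 s W b α ⊆ Ω :=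
  (bbHull_mono b (cubeOf_subset (hPd := hPd) (c := c) (W := W) α.1)).trans hΩ₀

end Hull

/-! ## §2 The two inputs of p31's row-restricted chain for a REGION `Ω`, at a background regular ON `Ω`, at one set of constants -/

section Inputs

/-- kernel: `e^{−δ'E} ≤ e^{−δE}` for `δ ≤ δ'`, `E ≥ 0`. [folklore] -/
private theorem exp_le_exp_of_rate {δ δ' E : ℝ} (hδ : δ ≤ δ') (hE : 0 ≤ E) : Real.exp (-(δ' * E)) ≤ Real.exp (-(δ * E)) :=
  Real.exp_le_exp.2 (neg_le_neg (mul_le_mul_of_nonneg_right hδ hE))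

/-- **THE TWO INPUTS OF p31's ROW-RESTRICTED CHAIN FOR A BIG-BLOCK REGION `Ω`, AT A BACKGROUND (2.23)-REGULAR ON `Ω`, AT ONE SET OF
CONSTANTS** (print p. 263: *"for (2.31) we assume smoothness throughout the subset Ω ⊂ T_η"*).  For `D ≥ 1` directions, `L ≥ 2`, `a > 0`, a
charge `e` and a regularity pair `(c, β)`, `β > 0`: there is `s₀` and, for every big-block exponent `s ≥ s₀`, constants `c₀, e₁ > 0` such that on
every torus of the series (`P.d = D`, `P.L = L`), at every level `1 ≤ k ≤ K` with `k + s ≤ m + K`, `3L^kL^s ≤ |T^{(0)}|`, for every union `Ω` of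
big blocks (side `L^kL^s`) and every real bond field `A` that is (2.23)-regular ON `Ω` (`L^kε|e|/e_k·|∂A|(z) ≤ c·e_k^{β−1}/L^k` for `z ∈ Ω`,
`0 < e_k ≤ e₁`), `u = e^{ieεA}`, `δ₀ = 1/(8L^s)`, `G_k(X,u) = gBox (α_kL^{kD}) ε⁻¹ u k X`:
(H1.10″) for `X = Ω` at its `rowMargin`-deep rows (p31's `hGΩ` with `X₀ = deepRows rowMargin Ω`); (H1.12″) for every big-block union `B ⊆ Ω`
against `Ω`, at the `rowMargin`-deep rows of `B`, depths to `T ∖ B` (p31's `hC`) — r01's `input110_regular_deep` / `input112_regular_deep` BY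
NAME at a common `s`, `c₀ = max`, `e₁ = min`, the rate `1/(4L^s)` of the (1.10) member weakened to `1/(8L^s)`.
[cite: BalabanImbrieJaffe1985, p.326 «also satisfy the regularity and decay estimates of [7]»]
[cite: Balaban1983RegularityDecay, Theorem p.573 (1.10), (1.11)–(1.12)] -/
theorem inputs_regular_region (D L : ℕ) (hD : 1 ≤ D) (hL : 2 ≤ L) {a : ℝ} (ha : 0 < a) (e creg β : ℝ) (hcreg : 0 ≤ creg)
    (hβ : 0 < β) :
    ∃ s₀ : ℕ, ∀ s : ℕ, s₀ ≤ s → ∃ c₀ e₁ : ℝ, 0 < c₀ ∧ 0 < e₁ ∧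
      ∀ (P : Params), P.d = D → P.L = L → ∀ {k : ℕ}, 1 ≤ k → k ≤ P.K → k + s ≤ P.m + P.K →
      3 * (L ^ k * L ^ s) ≤ P.sitesPerDir 0 →
      ∀ (Ω : Finset (Balaban1983to89.Site P 0)),
        (∀ z z' : Balaban1983to89.Site P 0, (∀ μ, (z μ).val / (L ^ k * L ^ s) = (z' μ).val / (L ^ k * L ^ s)) → (z ∈ Ω ↔ z' ∈ Ω)) →
      ∀ (A : PBond P 0 → ℝ) {ec : ℝ}, 0 < ec → ec ≤ e₁ →
      (∀ z ∈ Ω, ∀ (μ ν : Fin P.d),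
          P.spacing k * |e| / ec * |A ⟨z.shift μ, ν⟩ - A ⟨z, ν⟩| ≤ creg * ec ^ (β - 1) / (L : ℝ) ^ k) →
      (∀ x ∈ deepRows ((rowMargin L D k s : ℕ) : ℝ) Ω, ∀ (f : Balaban1983to89.Site P 0 → ℂ) (F Ds : ℝ), (∀ y, ‖f y‖ ≤ F) → 0 ≤ Ds →
          (∀ y, f y ≠ 0 → Ds ≤ B5Ineq137Torus.T P 0 x y) →
          ‖(gBox (B1RG242Torus.α P a k * (P.L : ℝ) ^ (k * P.d)) P.eps⁻¹ (expGauge P e A) k Ω *ᵥ f) x‖ ≤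
            P.spacing k ^ 2 * (c₀ * Real.exp (-(1 / (8 * (L : ℝ) ^ s) * (((P.L : ℝ) ^ k)⁻¹ * Ds))) * F)) ∧
      (∀ (B : Finset (Balaban1983to89.Site P 0)),
        (∀ z z' : Balaban1983to89.Site P 0, (∀ μ, (z μ).val / (L ^ k * L ^ s) = (z' μ).val / (L ^ k * L ^ s)) → (z ∈ B ↔ z' ∈ B)) →
        B ⊆ Ω →
        ∀ x ∈ deepRows ((rowMargin L D k s : ℕ) : ℝ) B, ∀ (f : Balaban1983to89.Site P 0 → ℂ) (F Ds Db Df : ℝ), (∀ y, ‖f y‖ ≤ F) →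
          (∀ y, y ∉ B → f y = 0) → 0 ≤ Ds → (∀ y, f y ≠ 0 → Ds ≤ B5Ineq137Torus.T P 0 x y) → 0 ≤ Db →
          (∀ w, w ∉ B → Db ≤ B5Ineq137Torus.T P 0 x w) → 0 ≤ Df → (∀ y, f y ≠ 0 → ∀ w, w ∉ B → Df ≤ B5Ineq137Torus.T P 0 y w) →
          ‖(gBox (B1RG242Torus.α P a k * (P.L : ℝ) ^ (k * P.d)) P.eps⁻¹ (expGauge P e A) k B *ᵥ f) x -
              (gBox (B1RG242Torus.α P a k * (P.L : ℝ) ^ (k * P.d)) P.eps⁻¹ (expGauge P e A) k Ω *ᵥ f) x‖ ≤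
            P.spacing k ^ 2 * (c₀ * Real.exp (-(1 / (8 * (L : ℝ) ^ s) * (((P.L : ℝ) ^ k)⁻¹ * Ds))) *
              Real.exp (-(1 / (8 * (L : ℝ) ^ s) * (((P.L : ℝ) ^ k)⁻¹ * (Db + Df)))) * F)) := by
  obtain ⟨s₂, H2⟩ := input110_regular_deep D L hD hL ha e creg β hcreg hβ
  obtain ⟨s₃, H3⟩ := input112_regular_deep D L hD hL ha e creg β hcreg hβ
  refine ⟨max s₂ s₃, fun s hs => ?_⟩
  have hs₂ : s₂ ≤ s := (le_max_left _ _).trans hs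
  have hs₃ : s₃ ≤ s := (le_max_right _ _).trans hs
  obtain ⟨c₂, e₂, hc₂, he₂, G2⟩ := H2 s hs₂
  obtain ⟨c₃, e₃, hc₃, he₃, G3⟩ := H3 s hs₃
  refine ⟨max c₂ c₃, min e₂ e₃, lt_max_of_lt_left hc₂, lt_min he₂ he₃, ?_⟩
  intro P hPd hPL k hk1 hkK hks hsize Ω hΩ A ec hec hece hreg
  have hLr : (0 : ℝ) < L := by exact_mod_cast (show 0 < L by omega)
  have hLs : (0 : ℝ) < (L : ℝ) ^ s := pow_pos hLr s
  have hPk : (0 : ℝ) < (P.L : ℝ) ^ k := pow_pos P.cast_L_pos k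
  have hrate : 1 / (8 * (L : ℝ) ^ s) ≤ 1 / (4 * (L : ℝ) ^ s) :=
    one_div_le_one_div_of_le (by positivity) (by nlinarith)
  have hsk2 : 0 ≤ P.spacing k ^ 2 := sq_nonneg _
  refine ⟨?_, ?_⟩
  · -- (H1.10″) for the region at its deep rows
    intro x hx f F Ds hF hDs hsupp
    have hF0 : 0 ≤ F := (norm_nonneg _).trans (hF x)
    have hrow : ∀ y, B5Ineq137Torus.T P 0 x y ≤
        ((2 * (5 * (L ^ k * L ^ s) / 8 + L ^ k) + 2 * (L ^ k * L ^ s) * (D + 1) : ℕ) : ℝ) → y ∈ Ω := by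
      intro y hy
      refine (mem_deepRows.1 hx) y (hy.trans ?_)
      unfold rowMargin
      exact_mod_cast Nat.le_succ _
    have h := G2 P hPd hPL hk1 hkK hks hsize Ω hΩ A hec (hece.trans (min_le_left _ _)) hreg x hrow f F Ds hF hsupp
    refine h.trans (mul_le_mul_of_nonneg_left ?_ hsk2)
    refine mul_le_mul_of_nonneg_right (mul_le_mul (le_max_left _ _)
      (exp_le_exp_of_rate hrate (mul_nonneg (inv_pos.2 hPk).le hDs)) (Real.exp_pos _).le
      (hc₂.le.trans (le_max_left _ _))) hF0
  · -- (H1.12″) for a big-block union inside the region, at its deep rows, depths to `T ∖ B`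
    intro B hB hBΩ x hx f F Ds Db Df hF hfB _ hsupp _ hDb _ hDf
    have hF0 : 0 ≤ F := (norm_nonneg _).trans (hF x)
    have hrow : ∀ y, B5Ineq137Torus.T P 0 x y ≤
        ((2 * (5 * (L ^ k * L ^ s) / 8 + L ^ k) + 2 * (L ^ k * L ^ s) * (D + 1) + 1 : ℕ) : ℝ) → y ∈ B := by
      intro y hy
      refine (mem_deepRows.1 hx) y ?_
      unfold rowMargin
      exact hy
    have h := G3 P hPd hPL hk1 hkK hks hsize B Ω hB hΩ hBΩ A hec (hece.trans (min_le_right _ _)) hreg x hrow f F Ds Db Df hF hfB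
      hsupp hDb hDf
    refine h.trans (mul_le_mul_of_nonneg_left ?_ hsk2)
    refine mul_le_mul_of_nonneg_right (mul_le_mul_of_nonneg_right (mul_le_mul_of_nonneg_right
      (le_max_right _ _) (Real.exp_pos _).le) (Real.exp_pos _).le) hF0

end Inputs

/-! ## §3 (2.31) (operator and kernel forms) and (2.35) for a general big-block region `Ω` at a background regular on `Ω` -/

section Members

variable {d : ℕ}

/-- kernel: a deeper chart margin implies a shallower one. [folklore] -/
private theorem depth_mono (hPd : P.d = d + 1) {n : ℕ} {c M0 : Fin (d + 1) → ℕ} {D D' : ℝ} (hDD : D ≤ D')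
    {x : Balaban1983to89.Site P 0}
    (hdeep : ∀ i, D' ≤ (boxCoord hPd n c x i : ℝ) ∧ (boxCoord hPd n c x i : ℝ) + D' ≤ (n * M0 i : ℕ) - 1) :
    ∀ i, D ≤ (boxCoord hPd n c x i : ℝ) ∧ (boxCoord hPd n c x i : ℝ) + D ≤ (n * M0 i : ℕ) - 1 :=
  fun i => ⟨hDD.trans (hdeep i).1, by linarith [(hdeep i).2]⟩

/-- kernel: **a point of `Ω₀` at chart depth `≥ ρ` is a `ρ`-deep row of every region containing `Ω₀`** (its sup-torus ball of radius `ρ` lies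
in `Ω₀`: p29's `mem_and_abs_sub_le_of_T_le`). [cite: BalabanImbrieJaffe1988, (2.31) p.263] -/
theorem mem_deepRows_of_depth (hPd : P.d = d + 1) {n : ℕ} {c M0 : Fin (d + 1) → ℕ} (hfit : ∀ i, c i * n + n * M0 i ≤ P.sitesPerDir 0)
    {ρ : ℝ} {Ω : Finset (Balaban1983to89.Site P 0)} (hΩ₀ : (cubeT hPd n c fun i => n * M0 i) ⊆ Ω) {x : Balaban1983to89.Site P 0}
    (hdeep : ∀ i, ρ ≤ (boxCoord hPd n c x i : ℝ) ∧ (boxCoord hPd n c x i : ℝ) + ρ ≤ (n * M0 i : ℕ) - 1) :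
    x ∈ deepRows ρ Ω :=
  mem_deepRows.2 fun _ hy => hΩ₀ (mem_and_abs_sub_le_of_T_le hPd hfit hdeep hy).1

/-- **(2.31), OPERATOR FORM, FOR A GENERAL BIG-BLOCK REGION `Ω ⊂ T_η` AT A BACKGROUND (2.23)-REGULAR ON `Ω`, FOR THE PRINTED DATA WITH
BIG-BLOCK CUBES** (p. 263: *"|(G_{k,loc}(u)f − G_k(Ω,u)f)(x)| ≦ e^{−cr(e_k)}e^{−c dist(suppt f,x)}‖f‖_∞, (2.31) for dist(x,Ω^c) ≧ O(r(e_k)) … for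
(2.31) we assume smoothness throughout the subset Ω ⊂ T_η"*).  `∃ s₀ ∀ s ≥ s₀ ∃ c₀ e₁ > 0` (from `(d, L, a, e, c, β, s)` only) such that on every
torus of the series (`P.d = d+1`, `P.L = L ≥ 2`), at every level `1 ≤ k ≤ K` with `k + s ≤ m + K`, `3L^kL^s ≤ |T^{(0)}|`, for EVERY union `Ω` of big
blocks (side `L^kL^s`), every real `A` that is (2.23)-regular ON `Ω` (`L^kε|e|/e_k·|∂A|(z) ≤ c·e_k^{β−1}/L^k`, `z ∈ Ω`, `0 < e_k ≤ e₁`),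
`u = e^{ieεA}`, every reference no-wrap box `Ω₀ = c·L^k + Π_i[0, L^kM₀_i)` with torus gap `≥ R` WHOSE BIG-BLOCK HULL LIES IN `Ω`
(`bbHull (L^kL^s) Ω₀ ⊆ Ω` — this is where print's *"dist(x, Ω^c) ≧ O(r(e_k))"* enters: the localization is read in a chart around `x` inside
`Ω`), grid spacing `s_g ≥ 1`, half-width `W ≥ 2s_g/3 + R₀/2 + R`, radii `R > rowMargin`, `0 ≤ R₁ < R₀`, every fine row `x ∈ Ω₀` of chart depth
`≥ R₀ + R` and every `f` with `‖f‖_∞ ≤ F` supported at sup-torus distance `≥ D ≥ 0` from `x`: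
`‖(G_{k,loc}(u)f)(x) − (G_k(Ω,u)f)(x)‖ ≤ (L^kε)²·c₀·(m·e^{−2δ₀R/L^k} + e^{−(δ₀/2)R₁/L^k})·e^{−(δ₀/2)D/L^k}·F`, `δ₀ = 1/(8L^s)`,
`m = (⌊(L^k − 1 + R₀)/s_g⌋ + 3)^{d+1}` — p31 v1.1's `opClose231_gen` BY NAME with `X₀ = deepRows rowMargin Ω`, the inputs of §2 (every hull
`□̃_α ⊆ Ω` by §1), the row facts (i) `rowHyp_i`, (ii) `rowHyp_ii_hull`, (iii) `rowHyp_iii`; r18 gen 24's `opClose231_regular_torus_cwt` is the case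
`Ω = T_η`. [cite: BalabanImbrieJaffe1988, (2.31) p.263] -/
theorem opClose231_regular_region_cwt (d L : ℕ) (hL : 2 ≤ L) {a : ℝ} (ha : 0 < a) (e creg β : ℝ) (hcreg : 0 ≤ creg) (hβ : 0 < β) :
    ∃ s₀ : ℕ, ∀ s : ℕ, s₀ ≤ s → ∃ c₀ e₁ : ℝ, 0 < c₀ ∧ 0 < e₁ ∧
      ∀ (P : Params) (hPd : P.d = d + 1), P.L = L → ∀ (k : ℕ), 1 ≤ k → k ≤ P.K → k + s ≤ P.m + P.K →
      3 * (L ^ k * L ^ s) ≤ P.sitesPerDir 0 →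
      ∀ (Ω : Finset (Balaban1983to89.Site P 0)),
        (∀ z z' : Balaban1983to89.Site P 0, (∀ μ, (z μ).val / (L ^ k * L ^ s) = (z' μ).val / (L ^ k * L ^ s)) → (z ∈ Ω ↔ z' ∈ Ω)) →
      ∀ (A : PBond P 0 → ℝ) (ec : ℝ), 0 < ec → ec ≤ e₁ →
      (∀ z ∈ Ω, ∀ (μ ν : Fin P.d),
          P.spacing k * |e| / ec * |A ⟨z.shift μ, ν⟩ - A ⟨z, ν⟩| ≤ creg * ec ^ (β - 1) / (L : ℝ) ^ k) →
      ∀ (c M0 : Fin (d + 1) → ℕ), (∀ i, c i * P.L ^ k + P.L ^ k * M0 i ≤ P.sitesPerDir 0) →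
        bbHull (L ^ k * L ^ s) (cubeT hPd (P.L ^ k) c fun i => P.L ^ k * M0 i) ⊆ Ω →
      ∀ (sg W : ℕ), 1 ≤ sg → ∀ (R R₀ R₁ : ℝ), ((rowMargin L (d + 1) k s : ℕ) : ℝ) < R → 0 ≤ R₁ → R₁ < R₀ →
        2 * (sg : ℝ) / 3 + R₀ / 2 + R ≤ W → (∀ i, ((P.L ^ k * M0 i : ℕ) : ℝ) + R ≤ P.sitesPerDir 0) →
      ∀ (x : Balaban1983to89.Site P 0), x ∈ (cubeT hPd (P.L ^ k) c fun i => P.L ^ k * M0 i) →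
        (∀ i, R₀ + R ≤ (boxCoord hPd (P.L ^ k) c x i : ℝ) ∧ (boxCoord hPd (P.L ^ k) c x i : ℝ) + (R₀ + R) ≤ (P.L ^ k * M0 i : ℕ) - 1) →
      ∀ (f : Balaban1983to89.Site P 0 → ℂ) (F D : ℝ), (∀ y, ‖f y‖ ≤ F) → 0 ≤ D → (∀ y, f y ≠ 0 → D ≤ B5Ineq137Torus.T P 0 x y) →
        ‖(gLocT (B1RG242Torus.α P a k * (P.L : ℝ) ^ (k * P.d)) P.eps⁻¹ (expGauge P e A) k
              (cubeFamB hPd (P.L ^ k) c M0 sg W (L ^ k * L ^ s)) (lamFam hPd (P.L ^ k) c M0 sg)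
              (cutoff R₁ R₀ (B5Ineq137Torus.T P 0)) *ᵥ f) x -
            (gBox (B1RG242Torus.α P a k * (P.L : ℝ) ^ (k * P.d)) P.eps⁻¹ (expGauge P e A) k Ω *ᵥ f) x‖ ≤
          P.spacing k ^ 2 * (c₀ * (((⌊(((P.L : ℝ) ^ k) - 1 + R₀) / sg⌋₊ : ℝ) + 3) ^ (d + 1) *
              Real.exp (-(1 / (8 * (L : ℝ) ^ s) * (((P.L : ℝ) ^ k)⁻¹ * (2 * R)))) +
                Real.exp (-(1 / (8 * (L : ℝ) ^ s) / 2 * (((P.L : ℝ) ^ k)⁻¹ * R₁)))) *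
            Real.exp (-(1 / (8 * (L : ℝ) ^ s) / 2 * (((P.L : ℝ) ^ k)⁻¹ * D))) * F) := by
  obtain ⟨s₀, H⟩ := inputs_regular_region (d + 1) L (Nat.succ_pos d) hL ha e creg β hcreg hβ
  refine ⟨s₀, fun s hs => ?_⟩
  obtain ⟨c₀, e₁, hc₀, he₁, I⟩ := H s hs
  refine ⟨c₀, e₁, hc₀, he₁, ?_⟩
  intro P hPd hPL k hk1 hkK hks hsize Ω hΩ A ec hec hece hreg c M0 hfit0 hΩ₀ sg W hsg R R₀ R₁ hRm hR₁ hR10 hW hgap x hx hdeep f F D hF hD hsupp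
  obtain ⟨I2, I3⟩ := I P hPd hPL hk1 hkK hks hsize Ω hΩ A hec hece hreg
  have hn : 1 ≤ P.L ^ k := Nat.one_le_pow _ _ P.L_pos
  have hk : 0 + k ≤ P.m + P.K := by omega
  have hR₀ : 0 ≤ R₀ := hR₁.trans hR10.le
  have hR : 0 ≤ R := le_trans (Nat.cast_nonneg _) hRm.le
  have hζ0 := cutoff_eq_zero_of_le (P := P) hR10
  have hF0 : 0 ≤ F := (norm_nonneg _).trans (hF x)
  have hδ₀ : (0 : ℝ) ≤ 1 / (8 * (L : ℝ) ^ s) := by positivity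
  have hdeep₀ := depth_mono hPd (show R₀ ≤ R₀ + R by linarith) hdeep
  have hΩ₀' : (cubeT hPd (P.L ^ k) c fun i => P.L ^ k * M0 i) ⊆ Ω := (subset_bbHull _ _).trans hΩ₀
  have hxX₀ : x ∈ deepRows ((rowMargin L (d + 1) k s : ℕ) : ℝ) Ω :=
    mem_deepRows_of_depth hPd hfit0 hΩ₀' (depth_mono hPd (show ((rowMargin L (d + 1) k s : ℕ) : ℝ) ≤ R₀ + R by linarith) hdeep)
  have hsub : ∀ α : ↥(labels (P.L ^ k) M0 sg), cubeFamB hPd (P.L ^ k) c M0 sg W (L ^ k * L ^ s) α ⊆ Ω :=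
    cubeFamB_subset_of_hull_subset hPd hΩ₀
  set S : Finset ↥(labels (P.L ^ k) M0 sg) :=
    (activeLabels hPd (P.L ^ k) c sg R₀ (blkIter k x)).subtype fun α => α ∈ labels (P.L ^ k) M0 sg with hSdef
  have hS : ∀ (α : ↥(labels (P.L ^ k) M0 sg)) (y : Balaban1983to89.Site P 0),
      cutoff R₁ R₀ (B5Ineq137Torus.T P 0) x y * lamFam hPd (P.L ^ k) c M0 sg α x y ≠ 0 → f y ≠ 0 → α ∈ S := by
    intro α y hne _
    rw [hSdef, Finset.mem_subtype]
    exact mem_activeLabels_of_ne_zero_of_deep hk hsg hfit0 hζ0 (mem_blockK.2 rfl) hdeep₀ hne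
  have hB := opClose231_gen (B1RG242Torus.α P a k * (P.L : ℝ) ^ (k * P.d)) P.eps⁻¹ (expGauge P e A) Ω
    (deepRows ((rowMargin L (d + 1) k s : ℕ) : ℝ) Ω)
    (cubeFamB hPd (P.L ^ k) c M0 sg W (L ^ k * L ^ s))
    (fun α => deepRows ((rowMargin L (d + 1) k s : ℕ) : ℝ) (cubeFamB hPd (P.L ^ k) c M0 sg W (L ^ k * L ^ s) α))
    (lam := lamFam hPd (P.L ^ k) c M0 sg) (ζ'' := cutoff R₁ R₀ (B5Ineq137Torus.T P 0))
    (sum_abs_lamT_le_one hfit0) (cutoff_mem_unitInterval R₁ R₀) hδ₀ hc₀.le I2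
    (fun α x hx f F D Db Df hF hfB hD hsD hDb hsDb hDf hsDf =>
      I3 (cubeFamB hPd (P.L ^ k) c M0 sg W (L ^ k * L ^ s) α) (bbHull_bigBlock _ _) (hsub α) x hx f F D Db Df hF hfB hD hsD hDb hsDb
        hDf hsDf)
    x hxX₀ hR (rowHyp_i hPd hfit0 hζ0 hx hdeep₀)
    (rowHyp_ii_hull hPd hn hsg hfit0 hR hR₀ hRm hgap hW (L ^ k * L ^ s) hζ0 hx hdeep) (rowHyp_iii hR10 x) f hF hD hsupp S hS
  refine hB.trans ?_
  have hcard : (S.card : ℝ) ≤ (⌊(((P.L : ℝ) ^ k) - 1 + R₀) / sg⌋₊ + 3) ^ (d + 1) := by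
    have h1 := card_subtype_activeLabels_le (hPd := hPd) (c := c) (M0 := M0) hn hsg hR₀ (blkIter k x)
    have e1 : (((P.L ^ k : ℕ) : ℕ) : ℝ) = (P.L : ℝ) ^ k := by push_cast; rfl
    rw [hSdef]
    rw [e1] at h1
    exact h1
  have hE1 := (Real.exp_pos (-(1 / (8 * (L : ℝ) ^ s) * (((P.L : ℝ) ^ k)⁻¹ * (2 * R))))).le
  have hE2 := (Real.exp_pos (-(1 / (8 * (L : ℝ) ^ s) / 2 * (((P.L : ℝ) ^ k)⁻¹ * D)))).le
  refine mul_le_mul_of_nonneg_left ?_ (sq_nonneg _)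
  refine mul_le_mul_of_nonneg_right (mul_le_mul_of_nonneg_right (mul_le_mul_of_nonneg_left ?_ hc₀.le) hE2) hF0
  exact add_le_add (mul_le_mul_of_nonneg_right hcard hE1) le_rfl

/-- **(2.31), KERNEL FORM, FOR A GENERAL BIG-BLOCK REGION `Ω` AT A BACKGROUND (2.23)-REGULAR ON `Ω`, FOR THE PRINTED DATA WITH BIG-BLOCK
CUBES**: with the data and hypotheses of `opClose231_regular_region_cwt`, for every fine row `x ∈ Ω₀` of chart depth `≥ R₀ + R` and EVERY
`y ∈ T^{(0)}`: `‖G_{k,loc}(u; x, y) − G_k(Ω, u; x, y)‖ ≤ (L^kε)²·c₀·(e^{−2δ₀R/L^k} + e^{−(δ₀/2)R₁/L^k})·e^{−(δ₀/2)|x−y|_T/L^k}`, `δ₀ = 1/(8L^s)`,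
`u = e^{ieεA}` — p31 v1.1's `close231_kernel_gen` BY NAME (convexity absorbs the multiplicity).
[cite: BalabanImbrieJaffe1988, (2.31) p.263] -/
theorem close231_regular_region_kernel_cwt (d L : ℕ) (hL : 2 ≤ L) {a : ℝ} (ha : 0 < a) (e creg β : ℝ) (hcreg : 0 ≤ creg)
    (hβ : 0 < β) :
    ∃ s₀ : ℕ, ∀ s : ℕ, s₀ ≤ s → ∃ c₀ e₁ : ℝ, 0 < c₀ ∧ 0 < e₁ ∧
      ∀ (P : Params) (hPd : P.d = d + 1), P.L = L → ∀ (k : ℕ), 1 ≤ k → k ≤ P.K → k + s ≤ P.m + P.K →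
      3 * (L ^ k * L ^ s) ≤ P.sitesPerDir 0 →
      ∀ (Ω : Finset (Balaban1983to89.Site P 0)),
        (∀ z z' : Balaban1983to89.Site P 0, (∀ μ, (z μ).val / (L ^ k * L ^ s) = (z' μ).val / (L ^ k * L ^ s)) → (z ∈ Ω ↔ z' ∈ Ω)) →
      ∀ (A : PBond P 0 → ℝ) (ec : ℝ), 0 < ec → ec ≤ e₁ →
      (∀ z ∈ Ω, ∀ (μ ν : Fin P.d),
          P.spacing k * |e| / ec * |A ⟨z.shift μ, ν⟩ - A ⟨z, ν⟩| ≤ creg * ec ^ (β - 1) / (L : ℝ) ^ k) →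
      ∀ (c M0 : Fin (d + 1) → ℕ), (∀ i, c i * P.L ^ k + P.L ^ k * M0 i ≤ P.sitesPerDir 0) →
        bbHull (L ^ k * L ^ s) (cubeT hPd (P.L ^ k) c fun i => P.L ^ k * M0 i) ⊆ Ω →
      ∀ (sg W : ℕ), 1 ≤ sg → ∀ (R R₀ R₁ : ℝ), ((rowMargin L (d + 1) k s : ℕ) : ℝ) < R → 0 ≤ R₁ → R₁ < R₀ →
        2 * (sg : ℝ) / 3 + R₀ / 2 + R ≤ W → (∀ i, ((P.L ^ k * M0 i : ℕ) : ℝ) + R ≤ P.sitesPerDir 0) →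
      ∀ (x : Balaban1983to89.Site P 0), x ∈ (cubeT hPd (P.L ^ k) c fun i => P.L ^ k * M0 i) →
        (∀ i, R₀ + R ≤ (boxCoord hPd (P.L ^ k) c x i : ℝ) ∧ (boxCoord hPd (P.L ^ k) c x i : ℝ) + (R₀ + R) ≤ (P.L ^ k * M0 i : ℕ) - 1) →
      ∀ y : Balaban1983to89.Site P 0,
        ‖gLocT (B1RG242Torus.α P a k * (P.L : ℝ) ^ (k * P.d)) P.eps⁻¹ (expGauge P e A) k
              (cubeFamB hPd (P.L ^ k) c M0 sg W (L ^ k * L ^ s)) (lamFam hPd (P.L ^ k) c M0 sg)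
              (cutoff R₁ R₀ (B5Ineq137Torus.T P 0)) x y -
            gBox (B1RG242Torus.α P a k * (P.L : ℝ) ^ (k * P.d)) P.eps⁻¹ (expGauge P e A) k Ω x y‖ ≤
          P.spacing k ^ 2 * (c₀ * (Real.exp (-(1 / (8 * (L : ℝ) ^ s) * (((P.L : ℝ) ^ k)⁻¹ * (2 * R)))) +
              Real.exp (-(1 / (8 * (L : ℝ) ^ s) / 2 * (((P.L : ℝ) ^ k)⁻¹ * R₁)))) *
            Real.exp (-(1 / (8 * (L : ℝ) ^ s) / 2 * (((P.L : ℝ) ^ k)⁻¹ * B5Ineq137Torus.T P 0 x y)))) := by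
  obtain ⟨s₀, H⟩ := inputs_regular_region (d + 1) L (Nat.succ_pos d) hL ha e creg β hcreg hβ
  refine ⟨s₀, fun s hs => ?_⟩
  obtain ⟨c₀, e₁, hc₀, he₁, I⟩ := H s hs
  refine ⟨c₀, e₁, hc₀, he₁, ?_⟩
  intro P hPd hPL k hk1 hkK hks hsize Ω hΩ A ec hec hece hreg c M0 hfit0 hΩ₀ sg W hsg R R₀ R₁ hRm hR₁ hR10 hW hgap x hx hdeep y
  obtain ⟨I2, I3⟩ := I P hPd hPL hk1 hkK hks hsize Ω hΩ A hec hece hreg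
  have hn : 1 ≤ P.L ^ k := Nat.one_le_pow _ _ P.L_pos
  have hR₀ : 0 ≤ R₀ := hR₁.trans hR10.le
  have hR : 0 ≤ R := le_trans (Nat.cast_nonneg _) hRm.le
  have hζ0 := cutoff_eq_zero_of_le (P := P) hR10
  have hδ₀ : (0 : ℝ) ≤ 1 / (8 * (L : ℝ) ^ s) := by positivity
  have hdeep₀ := depth_mono hPd (show R₀ ≤ R₀ + R by linarith) hdeep
  have hΩ₀' : (cubeT hPd (P.L ^ k) c fun i => P.L ^ k * M0 i) ⊆ Ω := (subset_bbHull _ _).trans hΩ₀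
  have hxX₀ : x ∈ deepRows ((rowMargin L (d + 1) k s : ℕ) : ℝ) Ω :=
    mem_deepRows_of_depth hPd hfit0 hΩ₀' (depth_mono hPd (show ((rowMargin L (d + 1) k s : ℕ) : ℝ) ≤ R₀ + R by linarith) hdeep)
  have hsub : ∀ α : ↥(labels (P.L ^ k) M0 sg), cubeFamB hPd (P.L ^ k) c M0 sg W (L ^ k * L ^ s) α ⊆ Ω :=
    cubeFamB_subset_of_hull_subset hPd hΩ₀
  exact close231_kernel_gen (B1RG242Torus.α P a k * (P.L : ℝ) ^ (k * P.d)) P.eps⁻¹ (expGauge P e A) Ω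
    (deepRows ((rowMargin L (d + 1) k s : ℕ) : ℝ) Ω)
    (cubeFamB hPd (P.L ^ k) c M0 sg W (L ^ k * L ^ s))
    (fun α => deepRows ((rowMargin L (d + 1) k s : ℕ) : ℝ) (cubeFamB hPd (P.L ^ k) c M0 sg W (L ^ k * L ^ s) α))
    (lam := lamFam hPd (P.L ^ k) c M0 sg) (ζ'' := cutoff R₁ R₀ (B5Ineq137Torus.T P 0))
    (sum_abs_lamT_le_one hfit0) (cutoff_mem_unitInterval R₁ R₀) hδ₀ hc₀.le I2
    (fun α x hx f F D Db Df hF hfB hD hsD hDb hsDb hDf hsDf =>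
      I3 (cubeFamB hPd (P.L ^ k) c M0 sg W (L ^ k * L ^ s) α) (bbHull_bigBlock _ _) (hsub α) x hx f F D Db Df hF hfB hD hsD hDb hsDb
        hDf hsDf)
    x hxX₀ hR (rowHyp_i hPd hfit0 hζ0 hx hdeep₀)
    (rowHyp_ii_hull hPd hn hsg hfit0 hR hR₀ hRm hgap hW (L ^ k * L ^ s) hζ0 hx hdeep) (rowHyp_iii hR10 x) y

/-- **(2.35) FOR A GENERAL BIG-BLOCK REGION `Ω` AT A BACKGROUND (2.23)-REGULAR ON `Ω`, FOR THE PRINTED DATA WITH BIG-BLOCK CUBES** (p. 263: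
*"|Δ_{k,loc}(u; x₁, x₂) − Δ_k(Ω, u; x₁, x₂)| ≦ e^{−cr(e_k)}e^{−c|x₁−x₂|} (2.35) for dist({x₁, x₂}, Ω^c) > O(r(e_k))"*; `u = e^{ieεA}`): with the
data and hypotheses of `opClose231_regular_region_cwt`, for every `k`-lattice site `y₁` whose block lies in `Ω₀` with chart margin `R₀ + R` and
every `y₂`:
`‖Δ_{k,loc}(u; y₁, y₂) − Δ_k(Ω, u; y₁, y₂)‖ ≤ A·a_k·c₀e^{δ₀/2}·(m·e^{−2δ₀R/L^k} + e^{−(δ₀/2)R₁/L^k})·e^{−(δ₀/2)|y₁−y₂|_{T^{(k)}}}`, `A = α_kL^{k(d+1)}`,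
`δ₀ = 1/(8L^s)` — p31 v1.1's `close235_gen` BY NAME (its X₀ = the `rowMargin`-deep rows of `Ω`, which contain the block of `y₁`); p31 gen 20's
`BIJ88Decay236RegularRegion.decay236_region_regular` is the companion (2.36) for `Δ_k(Ω,u)`. [cite: BalabanImbrieJaffe1988, (2.35) p.263] -/
theorem close235_regular_region_cwt (d L : ℕ) (hL : 2 ≤ L) {a : ℝ} (ha : 0 < a) (e creg β : ℝ) (hcreg : 0 ≤ creg) (hβ : 0 < β) :
    ∃ s₀ : ℕ, ∀ s : ℕ, s₀ ≤ s → ∃ c₀ e₁ : ℝ, 0 < c₀ ∧ 0 < e₁ ∧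
      ∀ (P : Params) (hPd : P.d = d + 1), P.L = L → ∀ (k : ℕ), 1 ≤ k → k ≤ P.K → k + s ≤ P.m + P.K →
      3 * (L ^ k * L ^ s) ≤ P.sitesPerDir 0 →
      ∀ (Ω : Finset (Balaban1983to89.Site P 0)),
        (∀ z z' : Balaban1983to89.Site P 0, (∀ μ, (z μ).val / (L ^ k * L ^ s) = (z' μ).val / (L ^ k * L ^ s)) → (z ∈ Ω ↔ z' ∈ Ω)) →
      ∀ (A : PBond P 0 → ℝ) (ec : ℝ), 0 < ec → ec ≤ e₁ →
      (∀ z ∈ Ω, ∀ (μ ν : Fin P.d),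
          P.spacing k * |e| / ec * |A ⟨z.shift μ, ν⟩ - A ⟨z, ν⟩| ≤ creg * ec ^ (β - 1) / (L : ℝ) ^ k) →
      ∀ (c M0 : Fin (d + 1) → ℕ), (∀ i, c i * P.L ^ k + P.L ^ k * M0 i ≤ P.sitesPerDir 0) →
        bbHull (L ^ k * L ^ s) (cubeT hPd (P.L ^ k) c fun i => P.L ^ k * M0 i) ⊆ Ω →
      ∀ (sg W : ℕ), 1 ≤ sg → ∀ (R R₀ R₁ : ℝ), ((rowMargin L (d + 1) k s : ℕ) : ℝ) < R → 0 ≤ R₁ → R₁ < R₀ →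
        2 * (sg : ℝ) / 3 + R₀ / 2 + R ≤ W → (∀ i, ((P.L ^ k * M0 i : ℕ) : ℝ) + R ≤ P.sitesPerDir 0) →
      ∀ (y₁ y₂ : Balaban1983to89.Site P (0 + k)),
        (∀ μ, (c (Fin.cast hPd μ) : ℝ) * P.L ^ k + (R₀ + R) ≤ (P.L : ℝ) ^ k * (y₁ μ).val ∧
          (P.L : ℝ) ^ k * (y₁ μ).val + P.L ^ k + (R₀ + R) ≤ (c (Fin.cast hPd μ) : ℝ) * P.L ^ k + (P.L : ℝ) ^ k * M0 (Fin.cast hPd μ)) →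
        ‖deltaLocT (B1RG242Torus.α P a k * (P.L : ℝ) ^ (k * P.d)) P.eps⁻¹ (expGauge P e A) k
              (cubeFamB hPd (P.L ^ k) c M0 sg W (L ^ k * L ^ s)) (lamFam hPd (P.L ^ k) c M0 sg)
              (cutoff R₁ R₀ (B5Ineq137Torus.T P 0)) y₁ y₂ -
            deltaRegion (B1RG242Torus.α P a k * (P.L : ℝ) ^ (k * P.d)) P.eps⁻¹ (expGauge P e A) k Ω y₁ y₂‖ ≤
          (B1RG242Torus.α P a k * (P.L : ℝ) ^ (k * P.d)) * (B1.aSeq a P.L k * (c₀ * Real.exp (1 / (8 * (L : ℝ) ^ s) / 2)) *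
            (((⌊(((P.L : ℝ) ^ k) - 1 + R₀) / sg⌋₊ : ℝ) + 3) ^ (d + 1) *
                Real.exp (-(1 / (8 * (L : ℝ) ^ s) * (((P.L : ℝ) ^ k)⁻¹ * (2 * R)))) +
              Real.exp (-(1 / (8 * (L : ℝ) ^ s) / 2 * (((P.L : ℝ) ^ k)⁻¹ * R₁)))) *
            Real.exp (-(1 / (8 * (L : ℝ) ^ s) / 2 * B5Ineq137Torus.T P (0 + k) y₁ y₂))) := by
  obtain ⟨s₀, H⟩ := inputs_regular_region (d + 1) L (Nat.succ_pos d) hL ha e creg β hcreg hβ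
  refine ⟨s₀, fun s hs => ?_⟩
  obtain ⟨c₀, e₁, hc₀, he₁, I⟩ := H s hs
  refine ⟨c₀, e₁, hc₀, he₁, ?_⟩
  intro P hPd hPL k hk1 hkK hks hsize Ω hΩ A ec hec hece hreg c M0 hfit0 hΩ₀ sg W hsg R R₀ R₁ hRm hR₁ hR10 hW hgap y₁ y₂ hdeepB
  obtain ⟨I2, I3⟩ := I P hPd hPL hk1 hkK hks hsize Ω hΩ A hec hece hreg
  have hn : 1 ≤ P.L ^ k := Nat.one_le_pow _ _ P.L_pos
  have hk : 0 + k ≤ P.m + P.K := by omega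
  have hR₀ : 0 ≤ R₀ := hR₁.trans hR10.le
  have hR : 0 ≤ R := le_trans (Nat.cast_nonneg _) hRm.le
  have hζ0 := cutoff_eq_zero_of_le (P := P) hR10
  have hδ₀ : (0 : ℝ) ≤ 1 / (8 * (L : ℝ) ^ s) := by positivity
  have hΩ₀' : (cubeT hPd (P.L ^ k) c fun i => P.L ^ k * M0 i) ⊆ Ω := (subset_bbHull _ _).trans hΩ₀
  have hsub : ∀ α : ↥(labels (P.L ^ k) M0 sg), cubeFamB hPd (P.L ^ k) c M0 sg W (L ^ k * L ^ s) α ⊆ Ω :=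
    cubeFamB_subset_of_hull_subset hPd hΩ₀
  have hxdeep := fun x (hx : x ∈ blockK k y₁) => mem_and_depth_of_mem_blockK hPd hk hfit0 (by linarith : 0 ≤ R₀ + R) hdeepB hx
  have hxdeep₀ := fun x (hx : x ∈ blockK k y₁) => depth_mono hPd (show R₀ ≤ R₀ + R by linarith) (hxdeep x hx).2
  have hxX₀ : ∀ x ∈ blockK k y₁, x ∈ deepRows ((rowMargin L (d + 1) k s : ℕ) : ℝ) Ω := fun x hx =>
    mem_deepRows_of_depth hPd hfit0 hΩ₀'
      (depth_mono hPd (show ((rowMargin L (d + 1) k s : ℕ) : ℝ) ≤ R₀ + R by linarith) (hxdeep x hx).2)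
  set S : Finset ↥(labels (P.L ^ k) M0 sg) :=
    (activeLabels hPd (P.L ^ k) c sg R₀ y₁).subtype fun α => α ∈ labels (P.L ^ k) M0 sg with hSdef
  have hS : ∀ x ∈ blockK k y₁, ∀ (α : ↥(labels (P.L ^ k) M0 sg)) (y : Balaban1983to89.Site P 0),
      cutoff R₁ R₀ (B5Ineq137Torus.T P 0) x y * lamFam hPd (P.L ^ k) c M0 sg α x y ≠ 0 → α ∈ S := by
    intro x hx α y hne
    rw [hSdef, Finset.mem_subtype]
    exact mem_activeLabels_of_ne_zero_of_deep hk hsg hfit0 hζ0 hx (hxdeep₀ x hx) hne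
  have hB := close235_gen hk1 hk ha P.eps⁻¹ (expGauge P e A) Ω (deepRows ((rowMargin L (d + 1) k s : ℕ) : ℝ) Ω)
    (cubeFamB hPd (P.L ^ k) c M0 sg W (L ^ k * L ^ s))
    (fun α => deepRows ((rowMargin L (d + 1) k s : ℕ) : ℝ) (cubeFamB hPd (P.L ^ k) c M0 sg W (L ^ k * L ^ s) α))
    (lam := lamFam hPd (P.L ^ k) c M0 sg) (ζ'' := cutoff R₁ R₀ (B5Ineq137Torus.T P 0))
    (sum_abs_lamT_le_one hfit0) (cutoff_mem_unitInterval R₁ R₀) hδ₀ hc₀.le I2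
    (fun α x hx f F D Db Df hF hfB hD hsD hDb hsDb hDf hsDf =>
      I3 (cubeFamB hPd (P.L ^ k) c M0 sg W (L ^ k * L ^ s) α) (bbHull_bigBlock _ _) (hsub α) x hx f F D Db Df hF hfB hD hsD hDb hsDb
        hDf hsDf)
    hR y₁ y₂ hxX₀ (fun x hx => rowHyp_i hPd hfit0 hζ0 (hxdeep x hx).1 (hxdeep₀ x hx))
    (fun x hx => rowHyp_ii_hull hPd hn hsg hfit0 hR hR₀ hRm hgap hW (L ^ k * L ^ s) hζ0 (hxdeep x hx).1 (hxdeep x hx).2)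
    (fun x _ => rowHyp_iii hR10 x) S hS
  refine hB.trans ?_
  have hak : 0 < B1.aSeq a P.L k := B1.aSeq_pos ha (B1RG242Torus.one_lt_cast_L P) hk1
  have hα : 0 < B1RG242Torus.α P a k := mul_pos hak (inv_pos.mpr (pow_pos (P.spacing_pos k) 2))
  have hA : 0 < B1RG242Torus.α P a k * (P.L : ℝ) ^ (k * P.d) := mul_pos hα (pow_pos P.cast_L_pos _)
  have hcard : (S.card : ℝ) ≤ (⌊(((P.L : ℝ) ^ k) - 1 + R₀) / sg⌋₊ + 3) ^ (d + 1) := by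
    have h1 := card_subtype_activeLabels_le (hPd := hPd) (c := c) (M0 := M0) hn hsg hR₀ y₁
    have e1 : (((P.L ^ k : ℕ) : ℕ) : ℝ) = (P.L : ℝ) ^ k := by push_cast; rfl
    rw [hSdef]
    rw [e1] at h1
    exact h1
  have hE1 := (Real.exp_pos (-(1 / (8 * (L : ℝ) ^ s) * (((P.L : ℝ) ^ k)⁻¹ * (2 * R))))).le
  have hE3 := (Real.exp_pos (-(1 / (8 * (L : ℝ) ^ s) / 2 * (B5Ineq137Torus.T P (0 + k) y₁ y₂)))).le
  refine mul_le_mul_of_nonneg_left ?_ hA.le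
  refine mul_le_mul_of_nonneg_right ?_ hE3
  refine mul_le_mul_of_nonneg_left ?_ (mul_pos hak (mul_pos hc₀ (Real.exp_pos _))).le
  exact add_le_add (mul_le_mul_of_nonneg_right hcard hE1) le_rfl

/-- **THE WHOLE TORUS IS THE LARGEST REGION**: r18 gen 24's members with `Ω = T_η` and `A` regular on the whole torus are the case `Ω = univ`
of this file's (the hull condition is trivial). [cite: BalabanImbrieJaffe1988, (2.31) p.263] -/
theorem opClose231_regular_region_cwt_univ (d L : ℕ) (hL : 2 ≤ L) {a : ℝ} (ha : 0 < a) (e creg β : ℝ) (hcreg : 0 ≤ creg) (hβ : 0 < β) :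
    ∃ s₀ : ℕ, ∀ s : ℕ, s₀ ≤ s → ∃ c₀ e₁ : ℝ, 0 < c₀ ∧ 0 < e₁ ∧
      ∀ (P : Params) (hPd : P.d = d + 1), P.L = L → ∀ (k : ℕ), 1 ≤ k → k ≤ P.K → k + s ≤ P.m + P.K →
      3 * (L ^ k * L ^ s) ≤ P.sitesPerDir 0 →
      ∀ (A : PBond P 0 → ℝ) (ec : ℝ), 0 < ec → ec ≤ e₁ →
      (∀ (z : Balaban1983to89.Site P 0) (μ ν : Fin P.d),
          P.spacing k * |e| / ec * |A ⟨z.shift μ, ν⟩ - A ⟨z, ν⟩| ≤ creg * ec ^ (β - 1) / (L : ℝ) ^ k) →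
      ∀ (c M0 : Fin (d + 1) → ℕ), (∀ i, c i * P.L ^ k + P.L ^ k * M0 i ≤ P.sitesPerDir 0) →
      ∀ (sg W : ℕ), 1 ≤ sg → ∀ (R R₀ R₁ : ℝ), ((rowMargin L (d + 1) k s : ℕ) : ℝ) < R → 0 ≤ R₁ → R₁ < R₀ →
        2 * (sg : ℝ) / 3 + R₀ / 2 + R ≤ W → (∀ i, ((P.L ^ k * M0 i : ℕ) : ℝ) + R ≤ P.sitesPerDir 0) →
      ∀ (x : Balaban1983to89.Site P 0), x ∈ (cubeT hPd (P.L ^ k) c fun i => P.L ^ k * M0 i) →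
        (∀ i, R₀ + R ≤ (boxCoord hPd (P.L ^ k) c x i : ℝ) ∧ (boxCoord hPd (P.L ^ k) c x i : ℝ) + (R₀ + R) ≤ (P.L ^ k * M0 i : ℕ) - 1) →
      ∀ (f : Balaban1983to89.Site P 0 → ℂ) (F D : ℝ), (∀ y, ‖f y‖ ≤ F) → 0 ≤ D → (∀ y, f y ≠ 0 → D ≤ B5Ineq137Torus.T P 0 x y) →
        ‖(gLocT (B1RG242Torus.α P a k * (P.L : ℝ) ^ (k * P.d)) P.eps⁻¹ (expGauge P e A) k
              (cubeFamB hPd (P.L ^ k) c M0 sg W (L ^ k * L ^ s)) (lamFam hPd (P.L ^ k) c M0 sg)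
              (cutoff R₁ R₀ (B5Ineq137Torus.T P 0)) *ᵥ f) x -
            (gBox (B1RG242Torus.α P a k * (P.L : ℝ) ^ (k * P.d)) P.eps⁻¹ (expGauge P e A) k univ *ᵥ f) x‖ ≤
          P.spacing k ^ 2 * (c₀ * (((⌊(((P.L : ℝ) ^ k) - 1 + R₀) / sg⌋₊ : ℝ) + 3) ^ (d + 1) *
              Real.exp (-(1 / (8 * (L : ℝ) ^ s) * (((P.L : ℝ) ^ k)⁻¹ * (2 * R)))) +
                Real.exp (-(1 / (8 * (L : ℝ) ^ s) / 2 * (((P.L : ℝ) ^ k)⁻¹ * R₁)))) *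
            Real.exp (-(1 / (8 * (L : ℝ) ^ s) / 2 * (((P.L : ℝ) ^ k)⁻¹ * D))) * F) := by
  obtain ⟨s₀, H⟩ := opClose231_regular_region_cwt d L hL ha e creg β hcreg hβ
  refine ⟨s₀, fun s hs => ?_⟩
  obtain ⟨c₀, e₁, hc₀, he₁, G⟩ := H s hs
  refine ⟨c₀, e₁, hc₀, he₁, ?_⟩
  intro P hPd hPL k hk1 hkK hks hsize A ec hec hece hreg c M0 hfit0 sg W hsg R R₀ R₁ hRm hR₁ hR10 hW hgap x hx hdeep f F D hF hD hsupp
  exact G P hPd hPL k hk1 hkK hks hsize univ (fun z z' _ => by simp) A ec hec hece (fun z _ μ ν => hreg z μ ν) c M0 hfit0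
    (subset_univ _) sg W hsg R R₀ R₁ hRm hR₁ hR10 hW hgap x hx hdeep f F D hF hD hsupp

end Members

/-! ## §4a Kernel (private copies of r18 gen 25's `BIJ88LocDerivHolder231RegularTorus` §1 — statements of record there): tail sources -/

section TailsCopy

open BIJ88LocDeriv230FlatTorus (abs_T_shift_sub_le)

variable {d : ℕ}

/-- kernel: **the tail source** `((ζ″(x′,y) − 1)f(y)` is bounded by `2‖f‖_∞` when `|ζ″| ≤ 1`. [cite: BalabanImbrieJaffe1988, (2.29) p.263] -/
private theorem norm_tail_le' {ζ : Balaban1983to89.Site P 0 → Balaban1983to89.Site P 0 → ℝ} (hζabs : ∀ x y, |ζ x y| ≤ 1)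
    (x : Balaban1983to89.Site P 0) {f : Balaban1983to89.Site P 0 → ℂ} {F : ℝ} (hF : ∀ y, ‖f y‖ ≤ F) (y : Balaban1983to89.Site P 0) :
    ‖((ζ x y : ℂ) - 1) * f y‖ ≤ 2 * F := by
  have hF0 : 0 ≤ F := (norm_nonneg _).trans (hF y)
  have hz1 : ‖(ζ x y : ℂ) - 1‖ ≤ 2 := by
    rw [← Complex.ofReal_one, ← Complex.ofReal_sub, Complex.norm_real, Real.norm_eq_abs, abs_le]
    have h := abs_le.1 (hζabs x y)
    constructor <;> linarith [h.1, h.2]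
  calc ‖((ζ x y : ℂ) - 1) * f y‖ = ‖(ζ x y : ℂ) - 1‖ * ‖f y‖ := norm_mul _ _
    _ ≤ 2 * F := mul_le_mul hz1 (hF y) (norm_nonneg _) (by norm_num)

/-- kernel: **the tail-difference source** `(ζ″(x+e_μ,y) − ζ″(x,y))f(y)` is bounded by the one-step modulus times `‖f‖_∞`.
[cite: BalabanImbrieJaffe1988, (2.29) p.263] -/
private theorem norm_tailDiff_le' {ζ : Balaban1983to89.Site P 0 → Balaban1983to89.Site P 0 → ℝ} {Kζ : ℝ} (hKζ : 0 ≤ Kζ)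
    {x : Balaban1983to89.Site P 0} {μ : Fin P.d} (hζlip : ∀ y, |ζ (x.shift μ) y - ζ x y| ≤ Kζ)
    {f : Balaban1983to89.Site P 0 → ℂ} {F : ℝ} (hF : ∀ y, ‖f y‖ ≤ F) (y : Balaban1983to89.Site P 0) :
    ‖((ζ (x.shift μ) y : ℂ) - (ζ x y : ℂ)) * f y‖ ≤ Kζ * F := by
  have hz : ‖(ζ (x.shift μ) y : ℂ) - (ζ x y : ℂ)‖ ≤ Kζ := by
    rw [← Complex.ofReal_sub, Complex.norm_real, Real.norm_eq_abs]; exact hζlip y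
  calc ‖((ζ (x.shift μ) y : ℂ) - (ζ x y : ℂ)) * f y‖ = ‖(ζ (x.shift μ) y : ℂ) - (ζ x y : ℂ)‖ * ‖f y‖ := norm_mul _ _
    _ ≤ Kζ * F := mul_le_mul hz (hF y) (norm_nonneg _) hKζ

/-- kernel: **where the tail source of the bond `⟨x, x+e_μ⟩` does not vanish, `f ≠ 0` and `|x − y|_T > R₁ − 1`** (`ζ″ = 1` within `R₁`, one
lattice step). [cite: BalabanImbrieJaffe1988, (2.29) p.263] -/
private theorem T_gt_of_tail_ne_zero' {ζ : Balaban1983to89.Site P 0 → Balaban1983to89.Site P 0 → ℝ} {R₁ : ℝ}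
    (hζR₁ : ∀ x y, B5Ineq137Torus.T P 0 x y ≤ R₁ → ζ x y = 1) (x : Balaban1983to89.Site P 0) (μ : Fin P.d)
    {f : Balaban1983to89.Site P 0 → ℂ} {y : Balaban1983to89.Site P 0} (hne : ((ζ (x.shift μ) y : ℂ) - 1) * f y ≠ 0) :
    f y ≠ 0 ∧ R₁ - 1 < B5Ineq137Torus.T P 0 x y := by
  refine ⟨right_ne_zero_of_mul hne, ?_⟩
  have hz : ζ (x.shift μ) y ≠ 1 := by
    intro h1; exact hne (by rw [h1]; push_cast; ring)
  have hgt : R₁ < B5Ineq137Torus.T P 0 (x.shift μ) y := lt_of_not_ge fun hle => hz (hζR₁ (x.shift μ) y hle)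
  have h1 := abs_le.1 (abs_T_shift_sub_le x y μ)
  linarith

/-- kernel: **where the tail-difference source does not vanish, `f ≠ 0` and `|x − y|_T > R₁ − 1`**. [cite: BalabanImbrieJaffe1988, (2.29) p.263] -/
private theorem T_gt_of_tailDiff_ne_zero' {ζ : Balaban1983to89.Site P 0 → Balaban1983to89.Site P 0 → ℝ} {R₁ : ℝ}
    (hζR₁ : ∀ x y, B5Ineq137Torus.T P 0 x y ≤ R₁ → ζ x y = 1) (x : Balaban1983to89.Site P 0) (μ : Fin P.d)
    {f : Balaban1983to89.Site P 0 → ℂ} {y : Balaban1983to89.Site P 0}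
    (hne : ((ζ (x.shift μ) y : ℂ) - (ζ x y : ℂ)) * f y ≠ 0) :
    f y ≠ 0 ∧ R₁ - 1 < B5Ineq137Torus.T P 0 x y := by
  refine ⟨right_ne_zero_of_mul hne, ?_⟩
  by_contra hle
  push Not at hle
  have h1 := abs_le.1 (abs_T_shift_sub_le x y μ)
  have hx : ζ x y = 1 := hζR₁ x y (by linarith)
  have hx' : ζ (x.shift μ) y = 1 := hζR₁ (x.shift μ) y (by linarith)
  exact hne (by rw [hx, hx']; push_cast; ring)

end TailsCopy

/-! ## §4 The covariant-derivative analogue of (2.31) for a general big-block region `Ω` at a background regular on `Ω`, generic Lipschitz cut-off -/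

section DerivRegion

open BIJ88Sect3Statements (cfg covD)
open BIJ88NeumannPropagatorFlatClose231 (norm_rowSource_le rowSource_ne_zero abs_lam_le_one)
open BIJ88LocDeriv231FlatTorus (covD_gLocT_sub_apply)
open BIJ88LocDeriv230FlatTorus (T_shift_le_one abs_T_shift_sub_le)
open BIJ88LocDeriv230ZetaPiFlatTorus (norm_rowSource_sub_le_of_lipschitz)
open BIJ85NeumannPropagatorRegularDeriv (input110_deriv_regular_deep input112_deriv_regular_deep)

variable {d : ℕ}

set_option maxHeartbeats 400000 in
/-- **THE COVARIANT-DERIVATIVE ANALOGUE OF (2.31) FOR A GENERAL BIG-BLOCK REGION `Ω` AT A BACKGROUND (2.23)-REGULAR ON `Ω`, FOR THE PRINTED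
LOCALIZATION DATA WITH BIG-BLOCK CUBES AND A GENERIC LIPSCHITZ CUT-OFF** (p. 263: *"Bounds analogous to (2.30), (2.31) hold for covariant
derivatives … of G_{k,loc}(u) of order less than two"*): r18 gen 25's `BIJ88LocDerivHolder231RegularTorus.deriv231_regular_of_lipschitz` (the case
`Ω = T_η`, `A` regular on the whole torus) VERBATIM with `T_η ↦ Ω ⊇ bbHull(Ω₀)` and the regularity of `A` assumed on `Ω` only — the four inputs are
r01's `input112_deriv_regular_deep` (`□̃_α ⊆ Ω`), `input110_deriv_regular_deep` (`X = Ω`, row `x`), and §2's two value members.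
`∃ s₀ ∀ s ≥ s₀ ∃ c₀ e₁ > 0` (from `(d, L, a, e, c, β, K₁, s)`): for the data of `opClose231_regular_region_cwt`, a cut-off with `|ζ″| ≤ 1`, `ζ″ = 0`
beyond `R₀`, `ζ″ = 1` within `R₁`, one-step modulus `K₁/(R₀ − R₁)`, radii `R > rowMargin + 1`, `0 ≤ R₁ < R₀`, every bond `⟨x, x+e_μ⟩` with both
endpoints in `Ω₀` at chart depth `≥ R₀ + R`, and every `f` with `‖f‖_∞ ≤ F` supported at sup-torus distance `≥ D ≥ 0` from `x`:
`‖D_u(G_{k,loc}(u)f)(⟨x,μ⟩) − D_u(G_k(Ω,u)f)(⟨x,μ⟩)‖ ≤`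
`(L^kε)·c₀·[m(1 + L^k((R₀−R₁)⁻¹ + s_g⁻¹))e^{−δ₀(2R−1)/L^k} + (1 + L^k(R₀−R₁)⁻¹)e^{−(δ₀/2)(R₁−1)/L^k}]·e^{−(δ₀/2)D/L^k}·F`, `δ₀ = 1/(8L^s)`,
`m = (⌊(L^k−1+R₀)/s_g⌋+3)^{d+1}`. [cite: BalabanImbrieJaffe1988, (2.31) p.263] -/
theorem deriv231_regular_region_of_lipschitz (d L : ℕ) (hL : 2 ≤ L) {a : ℝ} (ha : 0 < a) (e creg β : ℝ) (hcreg : 0 ≤ creg) (hβ : 0 < β)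
    {K₁ : ℝ} (hK₁ : 0 ≤ K₁) :
    ∃ s₀ : ℕ, ∀ s : ℕ, s₀ ≤ s → ∃ c₀ e₁ : ℝ, 0 < c₀ ∧ 0 < e₁ ∧
      ∀ (P : Params) (hPd : P.d = d + 1), P.L = L → ∀ (k : ℕ), 1 ≤ k → k ≤ P.K → k + s ≤ P.m + P.K →
      3 * (L ^ k * L ^ s) ≤ P.sitesPerDir 0 →
      ∀ (Ω : Finset (Balaban1983to89.Site P 0)),
        (∀ z z' : Balaban1983to89.Site P 0, (∀ μ, (z μ).val / (L ^ k * L ^ s) = (z' μ).val / (L ^ k * L ^ s)) → (z ∈ Ω ↔ z' ∈ Ω)) →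
      ∀ (A : PBond P 0 → ℝ) (ec : ℝ), 0 < ec → ec ≤ e₁ →
      (∀ z ∈ Ω, ∀ (μ ν : Fin P.d),
          P.spacing k * |e| / ec * |A ⟨z.shift μ, ν⟩ - A ⟨z, ν⟩| ≤ creg * ec ^ (β - 1) / (L : ℝ) ^ k) →
      ∀ (c M0 : Fin (d + 1) → ℕ), (∀ i, c i * P.L ^ k + P.L ^ k * M0 i ≤ P.sitesPerDir 0) → (∀ i, P.L ^ k * M0 i < P.sitesPerDir 0) →
        bbHull (L ^ k * L ^ s) (cubeT hPd (P.L ^ k) c fun i => P.L ^ k * M0 i) ⊆ Ω →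
      ∀ (sg W : ℕ), 1 ≤ sg → ∀ (R R₀ R₁ : ℝ), ((rowMargin L (d + 1) k s : ℕ) : ℝ) + 1 < R → 0 ≤ R₁ → R₁ < R₀ →
        2 * (sg : ℝ) / 3 + R₀ / 2 + R ≤ W → (∀ i, ((P.L ^ k * M0 i : ℕ) : ℝ) + R ≤ P.sitesPerDir 0) →
      ∀ (ζ : Balaban1983to89.Site P 0 → Balaban1983to89.Site P 0 → ℝ), (∀ x y, |ζ x y| ≤ 1) →
        (∀ x y, R₀ ≤ B5Ineq137Torus.T P 0 x y → ζ x y = 0) → (∀ x y, B5Ineq137Torus.T P 0 x y ≤ R₁ → ζ x y = 1) →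
        (∀ (x y : Balaban1983to89.Site P 0) (ν : Fin P.d), |ζ (x.shift ν) y - ζ x y| ≤ K₁ / (R₀ - R₁)) →
      ∀ (x : Balaban1983to89.Site P 0) (μ : Fin P.d),
        x ∈ (cubeT hPd (P.L ^ k) c fun i => P.L ^ k * M0 i) →
        (∀ i, R₀ + R ≤ (boxCoord hPd (P.L ^ k) c x i : ℝ) ∧ (boxCoord hPd (P.L ^ k) c x i : ℝ) + (R₀ + R) ≤ (P.L ^ k * M0 i : ℕ) - 1) →
        x.shift μ ∈ (cubeT hPd (P.L ^ k) c fun i => P.L ^ k * M0 i) →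
        (∀ i, R₀ + R ≤ (boxCoord hPd (P.L ^ k) c (x.shift μ) i : ℝ) ∧
          (boxCoord hPd (P.L ^ k) c (x.shift μ) i : ℝ) + (R₀ + R) ≤ (P.L ^ k * M0 i : ℕ) - 1) →
      ∀ (f : Balaban1983to89.Site P 0 → ℂ) (F D : ℝ), (∀ y, ‖f y‖ ≤ F) → 0 ≤ D → (∀ y, f y ≠ 0 → D ≤ B5Ineq137Torus.T P 0 x y) →
        ‖covD P.eps⁻¹ (cfg (expGauge P e A))
              (gLocT (B1RG242Torus.α P a k * (P.L : ℝ) ^ (k * P.d)) P.eps⁻¹ (expGauge P e A) k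
                (cubeFamB hPd (P.L ^ k) c M0 sg W (L ^ k * L ^ s)) (lamFam hPd (P.L ^ k) c M0 sg)
                ζ *ᵥ f) ⟨x, μ⟩ -
            covD P.eps⁻¹ (cfg (expGauge P e A))
              (gBox (B1RG242Torus.α P a k * (P.L : ℝ) ^ (k * P.d)) P.eps⁻¹ (expGauge P e A) k Ω *ᵥ f) ⟨x, μ⟩‖ ≤
          P.spacing k * (c₀ * ((((⌊(((P.L : ℝ) ^ k) - 1 + R₀) / sg⌋₊ : ℝ) + 3) ^ (d + 1)) *
                (1 + (P.L : ℝ) ^ k * ((R₀ - R₁)⁻¹ + (sg : ℝ)⁻¹)) *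
                Real.exp (-(1 / (8 * (L : ℝ) ^ s) * (((P.L : ℝ) ^ k)⁻¹ * (2 * R - 1)))) +
              (1 + (P.L : ℝ) ^ k * (R₀ - R₁)⁻¹) * Real.exp (-(1 / (8 * (L : ℝ) ^ s) / 2 * (((P.L : ℝ) ^ k)⁻¹ * (R₁ - 1))))) *
            Real.exp (-(1 / (8 * (L : ℝ) ^ s) / 2 * (((P.L : ℝ) ^ k)⁻¹ * D))) * F) := by
  obtain ⟨s₁, H1⟩ := input112_deriv_regular_deep (d + 1) L (Nat.succ_pos d) hL ha e creg β hcreg hβ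
  obtain ⟨s₂, H23⟩ := inputs_regular_region (d + 1) L (Nat.succ_pos d) hL ha e creg β hcreg hβ
  obtain ⟨s₃, H3⟩ := input110_deriv_regular_deep (d + 1) L (Nat.succ_pos d) hL ha e creg β hcreg hβ
  set Λ₀ : ℝ := max K₁ (3 * Real.pi * (d + 1 : ℕ) / 2) with hΛ₀def
  have hΛ₀0 : 0 ≤ Λ₀ := hK₁.trans (le_max_left _ _)
  have hΛ₀K : K₁ ≤ Λ₀ := le_max_left _ _
  refine ⟨max s₁ (max s₂ s₃), fun s hs => ?_⟩
  have hs₁ : s₁ ≤ s := (le_max_left _ _).trans hs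
  have hs₂ : s₂ ≤ s := ((le_max_left _ _).trans (le_max_right _ _)).trans hs
  have hs₃ : s₃ ≤ s := ((le_max_right _ _).trans (le_max_right _ _)).trans hs
  obtain ⟨c₁, e₁, hc₁, he₁, G1⟩ := H1 s hs₁
  obtain ⟨c₂, e₂, hc₂, he₂, G23⟩ := H23 s hs₂
  obtain ⟨c₃, e₃, hc₃, he₃, G3⟩ := H3 s hs₃
  set C : ℝ := max (max c₁ (2 * c₂ * Λ₀ + 1)) (max (2 * c₃) (c₂ * Λ₀ + 1)) with hCdef
  have hC1 : c₁ ≤ C := (le_max_left _ _).trans (le_max_left _ _)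
  have hC2 : 2 * c₂ * Λ₀ + 1 ≤ C := (le_max_right _ _).trans (le_max_left _ _)
  have hC3 : 2 * c₃ ≤ C := (le_max_left _ _).trans (le_max_right _ _)
  have hC4 : c₂ * Λ₀ + 1 ≤ C := (le_max_right _ _).trans (le_max_right _ _)
  have hC0 : 0 ≤ C := hc₁.le.trans hC1
  refine ⟨C, min e₁ (min e₂ e₃), lt_of_lt_of_le hc₁ hC1, lt_min he₁ (lt_min he₂ he₃), ?_⟩
  intro P hPd hPL k hk1 hkK hks hsize Ω hΩ A ec hec hece hreg c M0 hfit0 hN0 hΩ₀ sg W hsg R R₀ R₁ hRm hR₁ hR10 hW hgap ζ hζabs hζ0 hζR₁ hζ1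
    x μ hx hdeep hxe hdeepe f F D hF hD hsupp
  obtain ⟨I2, I3⟩ := G23 P hPd hPL hk1 hkK hks hsize Ω hΩ A hec (hece.trans ((min_le_right _ _).trans (min_le_left _ _))) hreg
  have hece₁ : ec ≤ e₁ := hece.trans (min_le_left _ _)
  have hece₃ : ec ≤ e₃ := hece.trans ((min_le_right _ _).trans (min_le_right _ _))
  have hn : 1 ≤ P.L ^ k := Nat.one_le_pow _ _ P.L_pos
  have hk : 0 + k ≤ P.m + P.K := by omega
  have hρR : ((rowMargin L (d + 1) k s : ℕ) : ℝ) < R := by linarith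
  have hR1 : 1 < R := by
    have : (0 : ℝ) ≤ ((rowMargin L (d + 1) k s : ℕ) : ℝ) := Nat.cast_nonneg _
    linarith
  have hR0 : 0 ≤ R := zero_le_one.trans hR1.le
  have hR₀ : 0 ≤ R₀ := hR₁.trans hR10.le
  have hs0 : 0 < sg := hsg
  have hsr : (0 : ℝ) < sg := by exact_mod_cast hs0
  have hgap' : 0 < R₀ - R₁ := sub_pos.2 hR10
  have hLr : (0 : ℝ) < L := by exact_mod_cast (show 0 < L by omega)
  have hLs : (0 : ℝ) < (L : ℝ) ^ s := pow_pos hLr s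
  have hLpos : (0 : ℝ) < P.L := P.cast_L_pos
  have hLk : (0 : ℝ) < (P.L : ℝ) ^ k := pow_pos hLpos _
  have hε : 0 < ((P.L : ℝ) ^ k)⁻¹ := inv_pos.mpr hLk
  have hF0 : 0 ≤ F := (norm_nonneg _).trans (hF x)
  have hsp0 : 0 < P.spacing k := P.spacing_pos k
  have heps : 0 < P.eps := P.eps_pos
  have hK₁' : 0 ≤ K₁ / (R₀ - R₁) := div_nonneg hK₁ (sub_pos.2 hR10).le
  have hdeep₀ := depth_mono hPd (show R₀ ≤ R₀ + R by linarith) hdeep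
  have hdeepe₀ := depth_mono hPd (show R₀ ≤ R₀ + R by linarith) hdeepe
  -- the rate and its comparisons
  set δ : ℝ := 1 / (8 * (L : ℝ) ^ s) with hδdef
  have hδ0 : 0 < δ := by positivity
  have hδ4 : δ ≤ 1 / (4 * (L : ℝ) ^ s) := one_div_le_one_div_of_le (by positivity) (by nlinarith)
  -- abbreviations
  set A' : ℝ := B1RG242Torus.α P a k * (P.L : ℝ) ^ (k * P.d) with hA'def
  set U : GaugeField P 0 U1 := expGauge P e A with hUdef
  set x' := x.shift μ with hx'def
  set cubeB := cubeFamB hPd (P.L ^ k) c M0 sg W (L ^ k * L ^ s) with hcubeBdef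
  set G₀ := gBox A' P.eps⁻¹ U k Ω with hG₀def
  set m : ℝ := ((⌊(((P.L : ℝ) ^ k) - 1 + R₀) / sg⌋₊ : ℝ) + 3) ^ (d + 1) with hmdef
  have hm0 : 0 ≤ m := by rw [hmdef]; positivity
  set E : ℝ := Real.exp (-(δ / 2 * (((P.L : ℝ) ^ k)⁻¹ * D))) with hEdef
  set E2R : ℝ := Real.exp (-(δ * (((P.L : ℝ) ^ k)⁻¹ * (2 * R - 1)))) with hE2Rdef
  set ER1 : ℝ := Real.exp (-(δ / 2 * (((P.L : ℝ) ^ k)⁻¹ * (R₁ - 1)))) with hER1def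
  have hE0 : 0 < E := Real.exp_pos _
  have hE2R0 : 0 < E2R := Real.exp_pos _
  have hER10 : 0 < ER1 := Real.exp_pos _
  have hεD : 0 ≤ ((P.L : ℝ) ^ k)⁻¹ * D := mul_nonneg hε.le hD
  have hε2R : 0 ≤ ((P.L : ℝ) ^ k)⁻¹ * (2 * R - 1) := mul_nonneg hε.le (by linarith)
  have hED : ∀ {δ'}, δ ≤ δ' → Real.exp (-(δ' * (((P.L : ℝ) ^ k)⁻¹ * D))) ≤ E := by
    intro δ' hδ'
    refine (exp_le_exp_of_rate hδ' hεD).trans (Real.exp_le_exp.2 ?_)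
    have := mul_nonneg hδ0.le hεD
    linarith
  have hE2 : ∀ {δ'}, δ ≤ δ' → Real.exp (-(δ' * (((P.L : ℝ) ^ k)⁻¹ * (R - 1 + R)))) ≤ E2R := by
    intro δ' hδ'
    rw [show R - 1 + R = 2 * R - 1 by ring]
    exact exp_le_exp_of_rate hδ' hε2R
  set D' : ℝ := max D (R₁ - 1) with hD'def
  have hD'D : D ≤ D' := le_max_left _ _
  have hD'R : R₁ - 1 ≤ D' := le_max_right _ _
  have hD'0 : 0 ≤ D' := hD.trans hD'D
  have hED' : ∀ {δ'}, δ ≤ δ' → Real.exp (-(δ' * (((P.L : ℝ) ^ k)⁻¹ * D'))) ≤ E * ER1 := by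
    intro δ' hδ'
    rw [hEdef, hER1def, ← Real.exp_add]
    refine Real.exp_le_exp.2 ?_
    have hD'0' : 0 ≤ ((P.L : ℝ) ^ k)⁻¹ * D' := mul_nonneg hε.le hD'0
    have h1 : δ * (((P.L : ℝ) ^ k)⁻¹ * D') ≤ δ' * (((P.L : ℝ) ^ k)⁻¹ * D') := mul_le_mul_of_nonneg_right hδ' hD'0'
    have h2 : δ / 2 * (((P.L : ℝ) ^ k)⁻¹ * D) + δ / 2 * (((P.L : ℝ) ^ k)⁻¹ * (R₁ - 1)) ≤ δ * (((P.L : ℝ) ^ k)⁻¹ * D') := by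
      have : D + (R₁ - 1) ≤ 2 * D' := by linarith
      calc δ / 2 * (((P.L : ℝ) ^ k)⁻¹ * D) + δ / 2 * (((P.L : ℝ) ^ k)⁻¹ * (R₁ - 1))
          = δ / 2 * (((P.L : ℝ) ^ k)⁻¹ * (D + (R₁ - 1))) := by ring
        _ ≤ δ / 2 * (((P.L : ℝ) ^ k)⁻¹ * (2 * D')) :=
            mul_le_mul_of_nonneg_left (mul_le_mul_of_nonneg_left this hε.le) (by positivity)
        _ = δ * (((P.L : ℝ) ^ k)⁻¹ * D') := by ring
    linarith
  -- the sources
  set g' : ↥(labels (P.L ^ k) M0 sg) → Balaban1983to89.Site P 0 → ℂ :=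
    fun α y => (ζ x' y : ℂ) * (lamFam hPd (P.L ^ k) c M0 sg α x' y : ℂ) * f y with hg'def
  set dg : ↥(labels (P.L ^ k) M0 sg) → Balaban1983to89.Site P 0 → ℂ :=
    fun α y => ((ζ x' y : ℂ) * (lamFam hPd (P.L ^ k) c M0 sg α x' y : ℂ) - (ζ x y : ℂ) * (lamFam hPd (P.L ^ k) c M0 sg α x y : ℂ)) * f y
    with hdgdef
  set q' : Balaban1983to89.Site P 0 → ℂ := fun y => ((ζ x' y : ℂ) - 1) * f y with hq'def
  set dq : Balaban1983to89.Site P 0 → ℂ := fun y => ((ζ x' y : ℂ) - (ζ x y : ℂ)) * f y with hdqdef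
  -- the four-term identity (row hypothesis (i) at both endpoints)
  have hid : covD P.eps⁻¹ (cfg U) (gLocT A' P.eps⁻¹ U k cubeB (lamFam hPd (P.L ^ k) c M0 sg) ζ *ᵥ f) ⟨x, μ⟩ -
      covD P.eps⁻¹ (cfg U) (G₀ *ᵥ f) ⟨x, μ⟩ =
      ∑ α, (covD P.eps⁻¹ (cfg U) (gBox A' P.eps⁻¹ U k (cubeB α) *ᵥ g' α) ⟨x, μ⟩ - covD P.eps⁻¹ (cfg U) (G₀ *ᵥ g' α) ⟨x, μ⟩) +
      ∑ α, ((P.eps⁻¹ : ℝ) : ℂ) * ((gBox A' P.eps⁻¹ U k (cubeB α) *ᵥ dg α) x - (G₀ *ᵥ dg α) x) +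
      covD P.eps⁻¹ (cfg U) (G₀ *ᵥ q') ⟨x, μ⟩ + ((P.eps⁻¹ : ℝ) : ℂ) * (G₀ *ᵥ dq) x :=
    covD_gLocT_sub_apply P.eps⁻¹ (cfg U) A' P.eps⁻¹ U k cubeB (lamFam hPd (P.L ^ k) c M0 sg) ζ G₀ f ⟨x, μ⟩
      (rowHyp_i hPd hfit0 hζ0 hxe hdeepe₀) (rowHyp_i hPd hfit0 hζ0 hx hdeep₀)
  rw [hid]
  -- the active-label sets of the two endpoints
  set Sx : Finset ↥(labels (P.L ^ k) M0 sg) := (activeLabels hPd (P.L ^ k) c sg R₀ (blkIter k x)).subtype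
    fun α => α ∈ labels (P.L ^ k) M0 sg with hSxdef
  set Sx' : Finset ↥(labels (P.L ^ k) M0 sg) := (activeLabels hPd (P.L ^ k) c sg R₀ (blkIter k x')).subtype
    fun α => α ∈ labels (P.L ^ k) M0 sg with hSx'def
  have hcardx : (Sx.card : ℝ) ≤ m := by
    have h1 := card_subtype_activeLabels_le (hPd := hPd) (c := c) (M0 := M0) hn hs0 hR₀ (blkIter k x)
    have e1 : (((P.L ^ k : ℕ) : ℕ) : ℝ) = (P.L : ℝ) ^ k := by push_cast; rfl
    rw [hSxdef, hmdef]; rw [e1] at h1; exact h1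
  have hcardx' : (Sx'.card : ℝ) ≤ m := by
    have h1 := card_subtype_activeLabels_le (hPd := hPd) (c := c) (M0 := M0) hn hs0 hR₀ (blkIter k x')
    have e1 : (((P.L ^ k : ℕ) : ℕ) : ℝ) = (P.L : ℝ) ^ k := by push_cast; rfl
    rw [hSx'def, hmdef]; rw [e1] at h1; exact h1
  have hSx : ∀ (α : ↥(labels (P.L ^ k) M0 sg)) (y : Balaban1983to89.Site P 0),
      ζ x y * lamFam hPd (P.L ^ k) c M0 sg α x y ≠ 0 → α ∈ Sx := by
    intro α y hne
    rw [hSxdef, Finset.mem_subtype]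
    exact mem_activeLabels_of_ne_zero_of_deep hk hs0 hfit0 hζ0 (mem_blockK.2 rfl) hdeep₀ hne
  have hSx' : ∀ (α : ↥(labels (P.L ^ k) M0 sg)) (y : Balaban1983to89.Site P 0),
      ζ x' y * lamFam hPd (P.L ^ k) c M0 sg α x' y ≠ 0 → α ∈ Sx' := by
    intro α y hne
    rw [hSx'def, Finset.mem_subtype]
    exact mem_activeLabels_of_ne_zero_of_deep hk hs0 hfit0 hζ0 (mem_blockK.2 rfl) hdeepe₀ hne
  have hcardU : ((Sx ∪ Sx').card : ℝ) ≤ 2 * m := by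
    have h1 : ((Sx ∪ Sx').card : ℝ) ≤ (Sx.card : ℝ) + (Sx'.card : ℝ) := by exact_mod_cast Finset.card_union_le _ _
    linarith
  -- geometry of an active hull READ AGAINST THE WHOLE TORUS, at either endpoint: the source `x` is `rowMargin`-deep in the hull,
  -- `T_η ∖ hull` is `≥ R − 1` away from `x` and `≥ R` away from every active source
  have hgeo' : ∀ (α : ↥(labels (P.L ^ k) M0 sg)) (y₀ : Balaban1983to89.Site P 0), ζ x' y₀ * lamFam hPd (P.L ^ k) c M0 sg α x' y₀ ≠ 0 →
      x ∈ deepRows ((rowMargin L (d + 1) k s : ℕ) : ℝ) (cubeB α) ∧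
      (∀ w, w ∉ cubeB α → R - 1 ≤ B5Ineq137Torus.T P 0 x w) ∧
      (∀ y, ζ x' y * lamFam hPd (P.L ^ k) c M0 sg α x' y ≠ 0 → y ∈ cubeB α ∧ ∀ w, w ∉ cubeB α → R ≤ B5Ineq137Torus.T P 0 y w) := by
    intro α y₀ hy₀
    have H := rowHyp_ii_hull hPd hn hs0 hfit0 hR0 hR₀ hρR hgap hW (L ^ k * L ^ s) hζ0 hxe hdeepe
    obtain ⟨-, -, hfar⟩ := H α y₀ hy₀
    have hfarx : ∀ w, w ∉ cubeB α → R - 1 ≤ B5Ineq137Torus.T P 0 x w := by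
      intro w hnot
      have h1 := (hfar w hnot).1
      have h2 := abs_le.1 (abs_T_shift_sub_le x w μ)
      linarith
    refine ⟨mem_deepRows.2 fun y hy => ?_, hfarx, fun y hy => ⟨(H α y hy).2.1, fun w hw => ((H α y hy).2.2 w hw).2⟩⟩
    by_contra hnot
    have := hfarx y hnot
    linarith
  have hgeo : ∀ (α : ↥(labels (P.L ^ k) M0 sg)) (y₀ : Balaban1983to89.Site P 0), ζ x y₀ * lamFam hPd (P.L ^ k) c M0 sg α x y₀ ≠ 0 →
      x ∈ deepRows ((rowMargin L (d + 1) k s : ℕ) : ℝ) (cubeB α) ∧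
      (∀ w, w ∉ cubeB α → R - 1 ≤ B5Ineq137Torus.T P 0 x w) ∧
      (∀ y, ζ x y * lamFam hPd (P.L ^ k) c M0 sg α x y ≠ 0 → y ∈ cubeB α ∧ ∀ w, w ∉ cubeB α → R ≤ B5Ineq137Torus.T P 0 y w) := by
    intro α y₀ hy₀
    have H := rowHyp_ii_hull hPd hn hs0 hfit0 hR0 hR₀ hρR hgap hW (L ^ k * L ^ s) hζ0 hx hdeep
    obtain ⟨hxd, -, hfar⟩ := H α y₀ hy₀
    exact ⟨hxd, fun w hnot => by linarith [(hfar w hnot).1],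
      fun y hy => ⟨(H α y hy).2.1, fun w hw => ((H α y hy).2.2 w hw).2⟩⟩
  have hrow_of_deep : ∀ {α : ↥(labels (P.L ^ k) M0 sg)}, x ∈ deepRows ((rowMargin L (d + 1) k s : ℕ) : ℝ) (cubeB α) →
      ∀ y, B5Ineq137Torus.T P 0 x y ≤
        ((2 * (5 * (L ^ k * L ^ s) / 8 + L ^ k) + 2 * (L ^ k * L ^ s) * (d + 1 + 1) + 1 : ℕ) : ℝ) → y ∈ cubeB α := by
    intro α hxd y hy
    refine (mem_deepRows.1 hxd) y ?_
    unfold rowMargin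
    exact hy
  -- the region contains the reference box and every hull; `x` is a deep row of the region
  have hΩ₀' : (cubeT hPd (P.L ^ k) c fun i => P.L ^ k * M0 i) ⊆ Ω := (subset_bbHull _ _).trans hΩ₀
  have hsub : ∀ α : ↥(labels (P.L ^ k) M0 sg), cubeB α ⊆ Ω := cubeFamB_subset_of_hull_subset hPd hΩ₀
  have hxX₀ : x ∈ deepRows ((rowMargin L (d + 1) k s : ℕ) : ℝ) Ω :=
    mem_deepRows_of_depth hPd hfit0 hΩ₀' (depth_mono hPd (show ((rowMargin L (d + 1) k s : ℕ) : ℝ) ≤ R₀ + R by linarith) hdeep)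
  have hxrow : ∀ y, B5Ineq137Torus.T P 0 x y ≤
      ((2 * (5 * (L ^ k * L ^ s) / 8 + L ^ k) + 2 * (L ^ k * L ^ s) * (d + 1 + 1) + 1 : ℕ) : ℝ) → y ∈ Ω := by
    intro y hy
    refine (mem_deepRows.1 hxX₀) y ?_
    unfold rowMargin
    exact hy
  -- TERM 1: the derivative member of (1.11)–(1.12) for `hull □_α ⊂ T_η` at the regular background (r01), for the hulls active at `x'`
  set B₁ : ℝ := P.spacing k * (c₁ * Real.exp (-(δ * (((P.L : ℝ) ^ k)⁻¹ * D))) *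
    Real.exp (-(δ * (((P.L : ℝ) ^ k)⁻¹ * (R - 1 + R)))) * F) with hB₁def
  have hB₁0 : 0 ≤ B₁ := by positivity
  have hterm1 : ∀ α, ‖covD P.eps⁻¹ (cfg U) (gBox A' P.eps⁻¹ U k (cubeB α) *ᵥ g' α) ⟨x, μ⟩ -
      covD P.eps⁻¹ (cfg U) (G₀ *ᵥ g' α) ⟨x, μ⟩‖ ≤ B₁ := by
    intro α
    by_cases hex : ∃ y, ζ x' y * lamFam hPd (P.L ^ k) c M0 sg α x' y ≠ 0
    · obtain ⟨y₀, hy₀⟩ := hex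
      obtain ⟨hxd, hfarx, hsrc⟩ := hgeo' α y₀ hy₀
      have hsuppα : ∀ y, y ∉ cubeB α → g' α y = 0 := by
        intro y hy
        by_contra hne
        exact hy (hsrc y (rowSource_ne_zero hne).1).1
      have hDf : ∀ y, g' α y ≠ 0 → ∀ w, w ∉ cubeB α → R ≤ B5Ineq137Torus.T P 0 y w :=
        fun y hy w hw' => (hsrc y (rowSource_ne_zero hy).1).2 w hw'
      have h1 := G1 P hPd hPL hk1 hkK hks hsize (cubeB α) Ω (bbHull_bigBlock _ _) hΩ (hsub α) A hec hece₁
        hreg x (hrow_of_deep hxd) (g' α) F D (R - 1) R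
        (fun y => norm_rowSource_le (hζabs x' y) (abs_lam_le_one (sum_abs_lamT_le_one hfit0) α x' y) hF y)
        hsuppα (fun y hy => hsupp y (rowSource_ne_zero hy).2) hfarx hDf μ
      have e1 : covD P.eps⁻¹ (cfg U) (G₀ *ᵥ g' α) ⟨x, μ⟩ =
          covD P.eps⁻¹ (cfg (expGauge P e A)) (gBox A' P.eps⁻¹ (expGauge P e A) k Ω *ᵥ g' α) ⟨x, μ⟩ := by rw [hG₀def]
      rw [e1]
      exact h1
    · push Not at hex
      have h0 : g' α = 0 := by
        funext y; rw [hg'def]; dsimp only; rw [← Complex.ofReal_mul, hex y, Complex.ofReal_zero, zero_mul]; rfl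
      rw [h0, mulVec_zero, mulVec_zero]
      simp only [covD, Pi.zero_apply, mul_zero, sub_zero, norm_zero]
      exact hB₁0
  have hzero1 : ∀ α, α ∉ Sx' → covD P.eps⁻¹ (cfg U) (gBox A' P.eps⁻¹ U k (cubeB α) *ᵥ g' α) ⟨x, μ⟩ -
      covD P.eps⁻¹ (cfg U) (G₀ *ᵥ g' α) ⟨x, μ⟩ = 0 := by
    intro α hα
    have h0 : g' α = 0 := by
      funext y
      by_contra hne
      exact hα (hSx' α y (rowSource_ne_zero hne).1)
    rw [h0, mulVec_zero, mulVec_zero]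
    simp only [covD, Pi.zero_apply, mul_zero, sub_zero]
  have hsum1 : ‖∑ α, (covD P.eps⁻¹ (cfg U) (gBox A' P.eps⁻¹ U k (cubeB α) *ᵥ g' α) ⟨x, μ⟩ -
      covD P.eps⁻¹ (cfg U) (G₀ *ᵥ g' α) ⟨x, μ⟩)‖ ≤ m * B₁ := by
    rw [← Finset.sum_subset (Finset.subset_univ Sx') (fun α _ hα => hzero1 α hα)]
    calc ‖∑ α ∈ Sx', (covD P.eps⁻¹ (cfg U) (gBox A' P.eps⁻¹ U k (cubeB α) *ᵥ g' α) ⟨x, μ⟩ -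
            covD P.eps⁻¹ (cfg U) (G₀ *ᵥ g' α) ⟨x, μ⟩)‖
        ≤ ∑ α ∈ Sx', ‖covD P.eps⁻¹ (cfg U) (gBox A' P.eps⁻¹ U k (cubeB α) *ᵥ g' α) ⟨x, μ⟩ -
            covD P.eps⁻¹ (cfg U) (G₀ *ᵥ g' α) ⟨x, μ⟩‖ := norm_sum_le _ _
      _ ≤ ∑ α ∈ Sx', B₁ := Finset.sum_le_sum fun α _ => hterm1 α
      _ = Sx'.card * B₁ := by rw [Finset.sum_const, nsmul_eq_mul]
      _ ≤ m * B₁ := mul_le_mul_of_nonneg_right hcardx' hB₁0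
  -- TERM 2: the value member of (1.11)–(1.12) for `hull □_α ⊂ T_η` (§3), on the difference sources, hulls active at `x` or `x'`
  set Λ : ℝ := K₁ / (R₀ - R₁) + 3 * Real.pi * (d + 1 : ℕ) / (2 * sg) with hΛdef
  have hΛ0 : 0 ≤ Λ := by rw [hΛdef]; positivity
  set B₂ : ℝ := P.spacing k ^ 2 * (c₂ * Real.exp (-(δ * (((P.L : ℝ) ^ k)⁻¹ * D))) *
    Real.exp (-(δ * (((P.L : ℝ) ^ k)⁻¹ * (R - 1 + R)))) * (Λ * F)) with hB₂def
  have hB₂0 : 0 ≤ B₂ := by positivity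
  have hterm2 : ∀ α, ‖(gBox A' P.eps⁻¹ U k (cubeB α) *ᵥ dg α) x - (G₀ *ᵥ dg α) x‖ ≤ B₂ := by
    intro α
    by_cases hex : ∃ y, dg α y ≠ 0
    · obtain ⟨y₀, hy₀⟩ := hex
      have hact : ∀ y, dg α y ≠ 0 →
          ζ x' y * lamFam hPd (P.L ^ k) c M0 sg α x' y ≠ 0 ∨ ζ x y * lamFam hPd (P.L ^ k) c M0 sg α x y ≠ 0 := by
        intro y hy
        by_contra hno
        rw [not_or, not_not, not_not] at hno
        apply hy
        rw [hdgdef]; dsimp only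
        rw [← Complex.ofReal_mul, ← Complex.ofReal_mul, hno.1, hno.2]; simp
      have hxfar : x ∈ deepRows ((rowMargin L (d + 1) k s : ℕ) : ℝ) (cubeB α) ∧
          ∀ w, w ∉ cubeB α → R - 1 ≤ B5Ineq137Torus.T P 0 x w := by
        rcases hact y₀ hy₀ with h1 | h1
        · exact ⟨(hgeo' α y₀ h1).1, (hgeo' α y₀ h1).2.1⟩
        · exact ⟨(hgeo α y₀ h1).1, (hgeo α y₀ h1).2.1⟩
      obtain ⟨hxd, hfarx⟩ := hxfar
      have hsuppα : ∀ y, y ∉ cubeB α → dg α y = 0 := by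
        intro y hy
        by_contra hne
        rcases hact y hne with h1 | h1
        · exact hy ((hgeo' α y h1).2.2 y h1).1
        · exact hy ((hgeo α y h1).2.2 y h1).1
      have hDf : ∀ y, dg α y ≠ 0 → ∀ w, w ∉ cubeB α → R ≤ B5Ineq137Torus.T P 0 y w := by
        intro y hy w hw'
        rcases hact y hy with h1 | h1
        · exact ((hgeo' α y h1).2.2 y h1).2 w hw'
        · exact ((hgeo α y h1).2.2 y h1).2 w hw'
      have h2 := I3 (cubeB α) (bbHull_bigBlock _ _) (hsub α) x hxd (dg α) (Λ * F) D (R - 1) R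
        (fun y => norm_rowSource_sub_le_of_lipschitz hPd hs0 hfit0 hN0 hK₁' hζabs (fun y => hζ1 x y μ) α.1 hx hxe hF y)
        hsuppα hD (fun y hy => hsupp y (right_ne_zero_of_mul hy)) (by linarith) hfarx hR0 hDf
      have e2 : (gBox A' P.eps⁻¹ U k (cubeB α) *ᵥ dg α) x - (G₀ *ᵥ dg α) x =
          (gBox A' P.eps⁻¹ (expGauge P e A) k (cubeB α) *ᵥ dg α) x - (gBox A' P.eps⁻¹ (expGauge P e A) k Ω *ᵥ dg α) x := by
        rw [hG₀def]
      rw [e2]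
      exact h2
    · push Not at hex
      have h0 : dg α = 0 := funext hex
      rw [h0, mulVec_zero, mulVec_zero, Pi.zero_apply, sub_zero, norm_zero]
      exact hB₂0
  have hzero2 : ∀ α, α ∉ Sx ∪ Sx' → (gBox A' P.eps⁻¹ U k (cubeB α) *ᵥ dg α) x - (G₀ *ᵥ dg α) x = 0 := by
    intro α hα
    rw [Finset.mem_union, not_or] at hα
    have h0 : dg α = 0 := by
      funext y
      rw [hdgdef]; dsimp only
      have h1 : ζ x' y * lamFam hPd (P.L ^ k) c M0 sg α x' y = 0 := by
        by_contra hne; exact hα.2 (hSx' α y hne)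
      have h2 : ζ x y * lamFam hPd (P.L ^ k) c M0 sg α x y = 0 := by
        by_contra hne; exact hα.1 (hSx α y hne)
      rw [← Complex.ofReal_mul, ← Complex.ofReal_mul, h1, h2]; simp
    rw [h0, mulVec_zero, mulVec_zero, Pi.zero_apply, sub_zero]
  have hsum2 : ‖∑ α, ((P.eps⁻¹ : ℝ) : ℂ) * ((gBox A' P.eps⁻¹ U k (cubeB α) *ᵥ dg α) x - (G₀ *ᵥ dg α) x)‖ ≤
      P.eps⁻¹ * (2 * m * B₂) := by
    rw [← Finset.mul_sum, norm_mul, Complex.norm_real, Real.norm_eq_abs, abs_of_pos (inv_pos.mpr heps)]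
    refine mul_le_mul_of_nonneg_left ?_ (inv_pos.mpr heps).le
    rw [← Finset.sum_subset (Finset.subset_univ (Sx ∪ Sx')) (fun α _ hα => hzero2 α hα)]
    calc ‖∑ α ∈ Sx ∪ Sx', ((gBox A' P.eps⁻¹ U k (cubeB α) *ᵥ dg α) x - (G₀ *ᵥ dg α) x)‖
        ≤ ∑ α ∈ Sx ∪ Sx', ‖(gBox A' P.eps⁻¹ U k (cubeB α) *ᵥ dg α) x - (G₀ *ᵥ dg α) x‖ := norm_sum_le _ _
      _ ≤ ∑ α ∈ Sx ∪ Sx', B₂ := Finset.sum_le_sum fun α _ => hterm2 α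
      _ = (Sx ∪ Sx').card * B₂ := by rw [Finset.sum_const, nsmul_eq_mul]
      _ ≤ 2 * m * B₂ := mul_le_mul_of_nonneg_right hcardU hB₂0
  -- TERM 3: the derivative member of (1.10) for `G_k(T_η,u)` at the regular background (r01), on the tail `q'`
  set B₃ : ℝ := P.spacing k * (c₃ * Real.exp (-(1 / (4 * (L : ℝ) ^ s) * (((P.L : ℝ) ^ k)⁻¹ * D'))) * (2 * F)) with hB₃def
  have hterm3 : ‖covD P.eps⁻¹ (cfg U) (G₀ *ᵥ q') ⟨x, μ⟩‖ ≤ B₃ := by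
    have hsq : ∀ y, q' y ≠ 0 → D' ≤ B5Ineq137Torus.T P 0 x y := fun y hy => by
      obtain ⟨hf, hT⟩ := T_gt_of_tail_ne_zero' hζR₁ x μ hy
      exact max_le (hsupp y hf) hT.le
    have h3 := G3 P hPd hPL hk1 hkK hks hsize Ω hΩ A hec hece₃ hreg x hxrow q' (2 * F) D' (fun y => norm_tail_le' hζabs x' hF y) hsq μ
    have e3 : covD P.eps⁻¹ (cfg U) (G₀ *ᵥ q') ⟨x, μ⟩ =
        covD P.eps⁻¹ (cfg (expGauge P e A)) (gBox A' P.eps⁻¹ (expGauge P e A) k Ω *ᵥ q') ⟨x, μ⟩ := by rw [hG₀def]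
    rw [e3]
    exact h3
  -- TERM 4: the value member of (1.10) for `G_k(T_η,u)` (§3), on the tail difference `dq`
  set B₄ : ℝ := P.spacing k ^ 2 * (c₂ * Real.exp (-(δ * (((P.L : ℝ) ^ k)⁻¹ * D'))) * (K₁ / (R₀ - R₁) * F)) with hB₄def
  have hterm4 : ‖((P.eps⁻¹ : ℝ) : ℂ) * (G₀ *ᵥ dq) x‖ ≤ P.eps⁻¹ * B₄ := by
    rw [norm_mul, Complex.norm_real, Real.norm_eq_abs, abs_of_pos (inv_pos.mpr heps)]
    refine mul_le_mul_of_nonneg_left ?_ (inv_pos.mpr heps).le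
    have hsq : ∀ y, dq y ≠ 0 → D' ≤ B5Ineq137Torus.T P 0 x y := fun y hy => by
      obtain ⟨hf, hT⟩ := T_gt_of_tailDiff_ne_zero' hζR₁ x μ hy
      exact max_le (hsupp y hf) hT.le
    have h4 := I2 x hxX₀ dq (K₁ / (R₀ - R₁) * F) D'
      (fun y => norm_tailDiff_le' hK₁' (fun y => hζ1 x y μ) hF y) hD'0 hsq
    have e4 : (G₀ *ᵥ dq) x = (gBox A' P.eps⁻¹ (expGauge P e A) k Ω *ᵥ dq) x := by rw [hG₀def]
    rw [e4]
    exact h4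
  -- assembling (verbatim from gen 23, with `c₄ = c₂`, `δ₁ = δ₂ = δ₄ = δ`, `δ₃ = 1/(4L^s)`)
  have hscale : P.eps⁻¹ * P.spacing k ^ 2 = P.spacing k * (P.L : ℝ) ^ k := by
    rw [Params.spacing]
    field_simp
  have hΛle : Λ ≤ Λ₀ * ((R₀ - R₁)⁻¹ + (sg : ℝ)⁻¹) := by
    rw [hΛdef, mul_add]
    refine add_le_add ?_ ?_
    · rw [div_eq_mul_inv]
      exact mul_le_mul_of_nonneg_right (le_max_left _ _) (inv_pos.mpr hgap').le
    · have e5 : 3 * Real.pi * (d + 1 : ℕ) / (2 * sg) = (3 * Real.pi * (d + 1 : ℕ) / 2) * (sg : ℝ)⁻¹ := by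
        field_simp
      rw [e5]
      exact mul_le_mul_of_nonneg_right (le_max_right _ _) (inv_pos.mpr hsr).le
  have hKle : K₁ / (R₀ - R₁) ≤ Λ₀ * (R₀ - R₁)⁻¹ := by
    rw [div_eq_mul_inv]; exact mul_le_mul_of_nonneg_right hΛ₀K (inv_pos.mpr hgap').le
  have h1 : m * B₁ ≤ P.spacing k * (C * (m * 1 * E2R) * E * F) := by
    have : B₁ ≤ P.spacing k * (C * E2R * E * F) := by
      rw [hB₁def]
      refine mul_le_mul_of_nonneg_left ?_ hsp0.le
      have := mul_le_mul (mul_le_mul hC1 (hED le_rfl) (Real.exp_pos _).le hC0) (hE2 le_rfl) (Real.exp_pos _).le (by positivity)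
      calc c₁ * Real.exp (-(δ * (((P.L : ℝ) ^ k)⁻¹ * D))) * Real.exp (-(δ * (((P.L : ℝ) ^ k)⁻¹ * (R - 1 + R)))) * F
          ≤ C * E * E2R * F := mul_le_mul_of_nonneg_right this hF0
        _ = C * E2R * E * F := by ring
    calc m * B₁ ≤ m * (P.spacing k * (C * E2R * E * F)) := mul_le_mul_of_nonneg_left this hm0
      _ = P.spacing k * (C * (m * 1 * E2R) * E * F) := by ring
  have h2 : P.eps⁻¹ * (2 * m * B₂) ≤ P.spacing k * (C * (m * ((P.L : ℝ) ^ k * ((R₀ - R₁)⁻¹ + (sg : ℝ)⁻¹)) * E2R) * E * F) := by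
    have e6 : P.eps⁻¹ * (2 * m * B₂) = P.spacing k * ((2 * c₂ * Λ) * m * (P.L : ℝ) ^ k *
        (Real.exp (-(δ * (((P.L : ℝ) ^ k)⁻¹ * D))) * Real.exp (-(δ * (((P.L : ℝ) ^ k)⁻¹ * (R - 1 + R))))) * F) := by
      rw [hB₂def]
      have : P.eps⁻¹ * (2 * m * (P.spacing k ^ 2 * (c₂ * Real.exp (-(δ * (((P.L : ℝ) ^ k)⁻¹ * D))) *
          Real.exp (-(δ * (((P.L : ℝ) ^ k)⁻¹ * (R - 1 + R)))) * (Λ * F)))) =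
          (P.eps⁻¹ * P.spacing k ^ 2) * (2 * c₂ * Λ * m *
            (Real.exp (-(δ * (((P.L : ℝ) ^ k)⁻¹ * D))) * Real.exp (-(δ * (((P.L : ℝ) ^ k)⁻¹ * (R - 1 + R))))) * F) := by ring
      rw [this, hscale]; ring
    rw [e6]
    refine mul_le_mul_of_nonneg_left ?_ hsp0.le
    have hcoef : 2 * c₂ * Λ * m * (P.L : ℝ) ^ k ≤ C * (m * ((P.L : ℝ) ^ k * ((R₀ - R₁)⁻¹ + (sg : ℝ)⁻¹))) := by
      have h3' : 2 * c₂ * Λ ≤ C * ((R₀ - R₁)⁻¹ + (sg : ℝ)⁻¹) := by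
        calc 2 * c₂ * Λ ≤ 2 * c₂ * (Λ₀ * ((R₀ - R₁)⁻¹ + (sg : ℝ)⁻¹)) := mul_le_mul_of_nonneg_left hΛle (by positivity)
          _ = (2 * c₂ * Λ₀) * ((R₀ - R₁)⁻¹ + (sg : ℝ)⁻¹) := by ring
          _ ≤ C * ((R₀ - R₁)⁻¹ + (sg : ℝ)⁻¹) := mul_le_mul_of_nonneg_right (by linarith) (by positivity)
      calc 2 * c₂ * Λ * m * (P.L : ℝ) ^ k = (2 * c₂ * Λ) * (m * (P.L : ℝ) ^ k) := by ring
        _ ≤ (C * ((R₀ - R₁)⁻¹ + (sg : ℝ)⁻¹)) * (m * (P.L : ℝ) ^ k) := mul_le_mul_of_nonneg_right h3' (by positivity)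
        _ = C * (m * ((P.L : ℝ) ^ k * ((R₀ - R₁)⁻¹ + (sg : ℝ)⁻¹))) := by ring
    have hexp : Real.exp (-(δ * (((P.L : ℝ) ^ k)⁻¹ * D))) * Real.exp (-(δ * (((P.L : ℝ) ^ k)⁻¹ * (R - 1 + R)))) ≤ E2R * E := by
      calc _ ≤ E * E2R := mul_le_mul (hED le_rfl) (hE2 le_rfl) (Real.exp_pos _).le hE0.le
        _ = E2R * E := mul_comm _ _
    calc 2 * c₂ * Λ * m * (P.L : ℝ) ^ k *
          (Real.exp (-(δ * (((P.L : ℝ) ^ k)⁻¹ * D))) * Real.exp (-(δ * (((P.L : ℝ) ^ k)⁻¹ * (R - 1 + R))))) * F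
        ≤ C * (m * ((P.L : ℝ) ^ k * ((R₀ - R₁)⁻¹ + (sg : ℝ)⁻¹))) * (E2R * E) * F :=
          mul_le_mul_of_nonneg_right (mul_le_mul hcoef hexp (by positivity) (by positivity)) hF0
      _ = C * (m * ((P.L : ℝ) ^ k * ((R₀ - R₁)⁻¹ + (sg : ℝ)⁻¹)) * E2R) * E * F := by ring
  have h3 : B₃ ≤ P.spacing k * (C * (1 * ER1) * E * F) := by
    rw [hB₃def]
    refine mul_le_mul_of_nonneg_left ?_ hsp0.le
    calc c₃ * Real.exp (-(1 / (4 * (L : ℝ) ^ s) * (((P.L : ℝ) ^ k)⁻¹ * D'))) * (2 * F)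
        = (2 * c₃) * Real.exp (-(1 / (4 * (L : ℝ) ^ s) * (((P.L : ℝ) ^ k)⁻¹ * D'))) * F := by ring
      _ ≤ C * (E * ER1) * F := mul_le_mul_of_nonneg_right (mul_le_mul hC3 (hED' hδ4) (Real.exp_pos _).le hC0) hF0
      _ = C * (1 * ER1) * E * F := by ring
  have h4 : P.eps⁻¹ * B₄ ≤ P.spacing k * (C * ((P.L : ℝ) ^ k * (R₀ - R₁)⁻¹ * ER1) * E * F) := by
    have e7 : P.eps⁻¹ * B₄ = P.spacing k * ((c₂ * (K₁ / (R₀ - R₁))) * (P.L : ℝ) ^ k * Real.exp (-(δ * (((P.L : ℝ) ^ k)⁻¹ * D'))) * F) := by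
      rw [hB₄def]
      have : P.eps⁻¹ * (P.spacing k ^ 2 * (c₂ * Real.exp (-(δ * (((P.L : ℝ) ^ k)⁻¹ * D'))) * (K₁ / (R₀ - R₁) * F))) =
          (P.eps⁻¹ * P.spacing k ^ 2) * (c₂ * (K₁ / (R₀ - R₁)) * Real.exp (-(δ * (((P.L : ℝ) ^ k)⁻¹ * D'))) * F) := by ring
      rw [this, hscale]; ring
    rw [e7]
    refine mul_le_mul_of_nonneg_left ?_ hsp0.le
    have hcoef : c₂ * (K₁ / (R₀ - R₁)) * (P.L : ℝ) ^ k ≤ C * ((P.L : ℝ) ^ k * (R₀ - R₁)⁻¹) := by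
      have h5 : c₂ * (K₁ / (R₀ - R₁)) ≤ C * (R₀ - R₁)⁻¹ := by
        calc c₂ * (K₁ / (R₀ - R₁)) ≤ c₂ * (Λ₀ * (R₀ - R₁)⁻¹) := mul_le_mul_of_nonneg_left hKle hc₂.le
          _ = (c₂ * Λ₀) * (R₀ - R₁)⁻¹ := by ring
          _ ≤ C * (R₀ - R₁)⁻¹ := mul_le_mul_of_nonneg_right (by linarith) (inv_pos.mpr hgap').le
      calc c₂ * (K₁ / (R₀ - R₁)) * (P.L : ℝ) ^ k ≤ C * (R₀ - R₁)⁻¹ * (P.L : ℝ) ^ k := mul_le_mul_of_nonneg_right h5 hLk.le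
        _ = C * ((P.L : ℝ) ^ k * (R₀ - R₁)⁻¹) := by ring
    calc c₂ * (K₁ / (R₀ - R₁)) * (P.L : ℝ) ^ k * Real.exp (-(δ * (((P.L : ℝ) ^ k)⁻¹ * D'))) * F
        ≤ C * ((P.L : ℝ) ^ k * (R₀ - R₁)⁻¹) * (E * ER1) * F :=
          mul_le_mul_of_nonneg_right (mul_le_mul hcoef (hED' le_rfl) (Real.exp_pos _).le (by positivity)) hF0
      _ = C * ((P.L : ℝ) ^ k * (R₀ - R₁)⁻¹ * ER1) * E * F := by ring
  refine ((norm_add_le _ _).trans (add_le_add ((norm_add_le _ _).trans (add_le_add ((norm_add_le _ _).trans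
    (add_le_add hsum1 hsum2)) hterm3)) hterm4)).trans ?_
  calc m * B₁ + P.eps⁻¹ * (2 * m * B₂) + B₃ + P.eps⁻¹ * B₄
      ≤ P.spacing k * (C * (m * 1 * E2R) * E * F) +
          P.spacing k * (C * (m * ((P.L : ℝ) ^ k * ((R₀ - R₁)⁻¹ + (sg : ℝ)⁻¹)) * E2R) * E * F) +
        P.spacing k * (C * (1 * ER1) * E * F) + P.spacing k * (C * ((P.L : ℝ) ^ k * (R₀ - R₁)⁻¹ * ER1) * E * F) :=
        add_le_add (add_le_add (add_le_add h1 h2) h3) h4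
    _ = P.spacing k * (C * (m * (1 + (P.L : ℝ) ^ k * ((R₀ - R₁)⁻¹ + (sg : ℝ)⁻¹)) * E2R +
          (1 + (P.L : ℝ) ^ k * (R₀ - R₁)⁻¹) * ER1) * E * F) := by
        ring

end DerivRegion

/-! ## §5 (v1.1) Non-vacuity: every hypothesis of `opClose231_regular_region_cwt` met at once, with a PROPER region `Ω ⊊ T^{(0)}`, on a genuine
`Setup` torus chosen after the thresholds -/

section Instance

open BIJ88NeumannPropagatorFlatDecayCube (mem_cubeT_iff_val)

/-- The instance torus of the series: `d = 1`, `L = 3` (odd), `K = 1`, `m = s + 6` — `|T^{(0)}| = 2·3^{s+7}` fine sites per direction.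
[cite: Balaban1987RG1, (0.1) p.251] -/
private theorem sites_Ps (s : ℕ) :
    (⟨1, 3, s + 6, 1, le_rfl, ⟨⟨1, rfl⟩, Nat.one_lt_succ_succ 1⟩⟩ : Params).sitesPerDir 0 = 2 * 3 ^ (s + 7) := by
  show 2 * 3 ^ (s + 6 + 1 - 0) = 2 * 3 ^ (s + 7)
  rfl

/-- kernel: `rowMargin 3 1 1 s ≤ 16·3^s + 7`. [folklore] -/
private theorem rowMargin_le (s : ℕ) : rowMargin 3 (0 + 1) 1 s ≤ 16 * 3 ^ s + 7 := by
  unfold rowMargin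
  have : (3 : ℕ) ^ 1 = 3 := by norm_num
  rw [this]
  omega

/-- **THE HYPOTHESES OF `opClose231_regular_region_cwt` ARE JOINTLY SATISFIABLE WITH A PROPER REGION — THRESHOLDS INCLUDED** (so the (2.31)
bound for a general region at a regular background is not a statement about the empty set, nor only about `Ω = T_η`): for every charge/coupling
data `(a, e, c, β)` THERE ARE a block exponent `s` (the threshold `s₀` itself), constants `c₀, e₁ > 0`, and — chosen AFTER them — the `Setup`
torus `ℤ/(2·3^{s+7})` (`d = 1`, `L = 3`, `m = s + 6`, `K = 1`), the level `k = 1`, the reference box `Ω₀ = [0, 3^{s+5})` (`c = 0`,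
`M₀ = 3^{s+4}`), THE REGION `Ω = bbHull (3·3^s) Ω₀ = [0, 3^{s+5})` (a union of big blocks MISSING the site `3^{s+5}` of the torus, so `Ω ≠ T^{(0)}`),
the background `A = 0` (regular on `Ω` at `e_k = e₁`), grid spacing `s_g = 1`, radii `R = rowMargin + 1`, `R₀ = 1`, `R₁ = 0`, half-width
`W = rowMargin + 3` and the site `x ≡ rowMargin + 2` of `Ω₀` at chart depth `≥ R₀ + R`, meeting EVERY displayed hypothesis; consequently the
(2.31) operator bound `‖(G_{k,loc}(u)f)(x) − (G_k(Ω,u)f)(x)‖ ≤ …` holds there for every source `f` (`D = 0`) — r18 gen 24's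
`opClose231_regular_torus_cwt_nonvacuous` with `T^{(0)} ↦ Ω`. [cite: BalabanImbrieJaffe1988, (2.31) p.263] -/
theorem opClose231_regular_region_cwt_nonvacuous {a : ℝ} (ha : 0 < a) (e creg β : ℝ) (hcreg : 0 ≤ creg) (hβ : 0 < β) :
    ∃ (s : ℕ) (P : Params) (hPd : P.d = 0 + 1), P.L = 3 ∧ P.sitesPerDir 0 = 2 * 3 ^ (s + 7) ∧
    ∃ c₀ e₁ : ℝ, 0 < c₀ ∧ 0 < e₁ ∧ ∃ (M W : ℕ) (R : ℝ) (x : Balaban1983to89.Site P 0), 0 < R ∧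
      x ∈ (cubeT hPd (P.L ^ 1) (fun _ => 0) fun i => P.L ^ 1 * (fun _ => M) i) ∧
      (∃ w : Balaban1983to89.Site P 0, w ∉ bbHull (3 ^ 1 * 3 ^ s) (cubeT hPd (P.L ^ 1) (fun _ => 0) fun i => P.L ^ 1 * (fun _ => M) i)) ∧
      ∀ (f : Balaban1983to89.Site P 0 → ℂ) (F : ℝ), (∀ y, ‖f y‖ ≤ F) →
        ‖(gLocT (B1RG242Torus.α P a 1 * (P.L : ℝ) ^ (1 * P.d)) P.eps⁻¹ (expGauge P e (fun _ => 0 : PBond P 0 → ℝ)) 1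
              (cubeFamB hPd (P.L ^ 1) (fun _ => 0) (fun _ => M) 1 W (3 ^ 1 * 3 ^ s)) (lamFam hPd (P.L ^ 1) (fun _ => 0) (fun _ => M) 1)
              (cutoff 0 1 (B5Ineq137Torus.T P 0)) *ᵥ f) x -
            (gBox (B1RG242Torus.α P a 1 * (P.L : ℝ) ^ (1 * P.d)) P.eps⁻¹ (expGauge P e (fun _ => 0 : PBond P 0 → ℝ)) 1
              (bbHull (3 ^ 1 * 3 ^ s) (cubeT hPd (P.L ^ 1) (fun _ => 0) fun i => P.L ^ 1 * (fun _ => M) i)) *ᵥ f) x‖ ≤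
          P.spacing 1 ^ 2 * (c₀ * (((⌊(((P.L : ℝ) ^ 1) - 1 + 1) / (1 : ℕ)⌋₊ : ℝ) + 3) ^ (0 + 1) *
              Real.exp (-(1 / (8 * (3 : ℝ) ^ s) * (((P.L : ℝ) ^ 1)⁻¹ * (2 * R)))) +
                Real.exp (-(1 / (8 * (3 : ℝ) ^ s) / 2 * (((P.L : ℝ) ^ 1)⁻¹ * 0)))) *
            Real.exp (-(1 / (8 * (3 : ℝ) ^ s) / 2 * (((P.L : ℝ) ^ 1)⁻¹ * 0))) * F) := by
  obtain ⟨s₀, H0⟩ := opClose231_regular_region_cwt 0 3 (by norm_num) ha e creg β hcreg hβ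
  obtain ⟨c₀, e₁, hc₀, he₁, H⟩ := H0 s₀ le_rfl
  set s := s₀ with hsdef
  -- the torus, the margin, the box, the point
  set P : Params := ⟨1, 3, s + 6, 1, le_rfl, ⟨⟨1, rfl⟩, Nat.one_lt_succ_succ 1⟩⟩ with hPdef
  have hN : P.sitesPerDir 0 = 2 * 3 ^ (s + 7) := sites_Ps s
  set ρ : ℕ := rowMargin 3 (0 + 1) 1 s with hρdef
  have hρ : ρ ≤ 16 * 3 ^ s + 7 := rowMargin_le s
  have hX1 : 1 ≤ 3 ^ s := Nat.one_le_pow _ _ (by norm_num)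
  have h35 : (3 : ℕ) ^ (s + 5) = 243 * 3 ^ s := by rw [pow_add]; ring
  have h37 : (3 : ℕ) ^ (s + 7) = 2187 * 3 ^ s := by rw [pow_add]; ring
  have h34 : (3 : ℕ) ^ 1 * 3 ^ (s + 4) = 3 ^ (s + 5) := by rw [← pow_add]; ring_nf
  have h31 : (3 : ℕ) ^ 1 * 3 ^ s = 3 * 3 ^ s := by norm_num
  set v : ℕ := ρ + 2 with hvdef
  have hvN : v < P.sitesPerDir 0 := by rw [hN, h37]; omega
  set x : Balaban1983to89.Site P 0 := fun _ => ((v : ℕ) : ZMod (P.sitesPerDir 0)) with hxdef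
  have hxv : ∀ μ : Fin P.d, (x μ).val = v := by
    intro μ
    show ZMod.val ((v : ℕ) : ZMod (P.sitesPerDir 0)) = v
    rw [ZMod.val_natCast, Nat.mod_eq_of_lt hvN]
  have hfit : ∀ i : Fin (0 + 1), (fun _ => 0 : Fin (0 + 1) → ℕ) i * P.L ^ 1 + P.L ^ 1 * (fun _ => 3 ^ (s + 4) : Fin (0 + 1) → ℕ) i ≤
      P.sitesPerDir 0 := by
    intro i
    show 0 * 3 ^ 1 + 3 ^ 1 * 3 ^ (s + 4) ≤ P.sitesPerDir 0
    rw [hN, h34, h35, h37]; omega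
  have hxmem : x ∈ (cubeT rfl (P.L ^ 1) (fun _ => 0) fun i => P.L ^ 1 * (fun _ => 3 ^ (s + 4) : Fin (0 + 1) → ℕ) i) := by
    rw [mem_cubeT_iff_val rfl hfit]
    intro μ
    rw [hxv μ]
    show 0 * 3 ^ 1 ≤ v ∧ v < 0 * 3 ^ 1 + 3 ^ 1 * 3 ^ (s + 4)
    rw [h34, h35]; omega
  -- the region: the big-block hull of `Ω₀` (= `Ω₀` itself, block-aligned), a union of big blocks missing the site `3^{s+5}`
  set Ω : Finset (Balaban1983to89.Site P 0) :=
    bbHull (3 ^ 1 * 3 ^ s) (cubeT (rfl : P.d = 0 + 1) (P.L ^ 1) (fun _ => 0) fun i => P.L ^ 1 * (fun _ => 3 ^ (s + 4) : Fin (0 + 1) → ℕ) i)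
    with hΩdef
  have hwN : 3 ^ (s + 5) < P.sitesPerDir 0 := by rw [hN, h35, h37]; omega
  set w : Balaban1983to89.Site P 0 := fun _ => ((3 ^ (s + 5) : ℕ) : ZMod (P.sitesPerDir 0)) with hwdef
  have hwv : ∀ μ : Fin P.d, (w μ).val = 3 ^ (s + 5) := by
    intro μ
    show ZMod.val (((3 ^ (s + 5) : ℕ) : ℕ) : ZMod (P.sitesPerDir 0)) = 3 ^ (s + 5)
    rw [ZMod.val_natCast, Nat.mod_eq_of_lt hwN]
  have hwout : w ∉ Ω := by
    intro hw
    obtain ⟨y, hy, hwy⟩ := mem_bbHull.1 hw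
    set μ0 : Fin P.d := ⟨0, by show 0 < 1; exact Nat.one_pos⟩ with hμ0def
    have hy0 := ((mem_cubeT_iff_val rfl hfit y).1 hy) μ0
    have hμ := hwy μ0
    rw [hwv μ0] at hμ
    have hy1 : (y μ0).val < 3 ^ (s + 5) := by
      have := hy0.2
      simp only [zero_mul, zero_add] at this
      rw [h34] at this
      exact this
    have e1 : 3 ^ (s + 5) / (3 ^ 1 * 3 ^ s) = 81 := by
      rw [h31, h35, show 243 * 3 ^ s = 81 * (3 * 3 ^ s) by ring]
      exact Nat.mul_div_cancel _ (by positivity)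
    have e2 : (y μ0).val / (3 ^ 1 * 3 ^ s) < 81 := by
      rw [h31]
      refine (Nat.div_lt_iff_lt_mul (by positivity)).2 ?_
      rw [h35] at hy1
      linarith
    rw [e1] at hμ
    omega
  refine ⟨s, P, rfl, rfl, hN, c₀, e₁, hc₀, he₁, 3 ^ (s + 4), ρ + 3, (ρ : ℝ) + 1, x, by positivity, hxmem, ⟨w, hwout⟩, fun f F hF => ?_⟩
  set A0 : PBond P 0 → ℝ := fun _ => 0 with hA0def
  have hreg : ∀ z ∈ Ω, ∀ (μ ν : Fin P.d),
      P.spacing 1 * |e| / e₁ * |A0 ⟨z.shift μ, ν⟩ - A0 ⟨z, ν⟩| ≤ creg * e₁ ^ (β - 1) / (3 : ℝ) ^ 1 := by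
    intro z _ μ ν
    rw [hA0def, sub_self, abs_zero, mul_zero]
    exact div_nonneg (mul_nonneg hcreg (Real.rpow_nonneg he₁.le _)) (by norm_num)
  have h := H P rfl rfl 1 le_rfl le_rfl (by show 1 + s ≤ s + 6 + 1; omega) (by rw [hN, h37]; omega) Ω (bbHull_bigBlock _ _) A0 e₁ he₁
    le_rfl hreg (fun _ => 0) (fun _ => 3 ^ (s + 4)) hfit (by rw [hΩdef]) 1 (ρ + 3) le_rfl ((ρ : ℝ) + 1) 1 0 (by rw [hρdef]; linarith) le_rfl
    one_pos (by push_cast; linarith) (fun i => ?_) x hxmem (fun i => ?_) f F 0 hF le_rfl (fun y _ => B5Ineq137Torus.T_nonneg P 0 x y)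
  · rw [hΩdef] at h
    simpa using h
  · rw [hN]
    have e1 : ((P.L ^ 1 * 3 ^ (s + 4) : ℕ) : ℝ) = 243 * (3 : ℝ) ^ s := by
      rw [show P.L = 3 from rfl, h34, h35]; push_cast; ring
    rw [e1]; push_cast
    have hρr : (ρ : ℝ) ≤ 16 * (3 : ℝ) ^ s + 7 := by exact_mod_cast hρ
    have hX : (1 : ℝ) ≤ (3 : ℝ) ^ s := by exact_mod_cast hX1
    rw [show ((3 : ℝ)) ^ (s + 7) = 2187 * (3 : ℝ) ^ s by rw [pow_add]; ring]
    linarith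
  · have hb : (boxCoord (rfl : P.d = 0 + 1) (P.L ^ 1) (fun _ => 0) x i : ℝ) = v := by
      unfold boxCoord
      rw [hxv (Fin.cast (rfl : P.d = 0 + 1).symm i)]
      push_cast
      ring
    rw [hb]
    have e1 : ((P.L ^ 1 * 3 ^ (s + 4) : ℕ) : ℝ) = 243 * (3 : ℝ) ^ s := by
      rw [show P.L = 3 from rfl, h34, h35]; push_cast; ring
    rw [e1, hvdef]; push_cast
    have hρr : (ρ : ℝ) ≤ 16 * (3 : ℝ) ^ s + 7 := by exact_mod_cast hρ
    have hX : (1 : ℝ) ≤ (3 : ℝ) ^ s := by exact_mod_cast hX1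
    constructor <;> linarith

end Instance

/-! ## §6 (v1.1) The gauge orbit: (2.31) for the region `Ω` at every gauge transform `u = (e^{ieεA})^h` of a background regular on `Ω` -/

section GaugeOrbit

open BIJ88Sect3Statements (toC norm_toC)
open BIJ88DeltaLoc234Torus (mulOp gLocT_gaugeAct gBox_gaugeAct)
open BIJ88NeumannNoZeroModesTorus (IsBlockUnion)
open BIJ85NeumannPropagatorRegularDecay (isBlockUnion_of_bigBlocks)
open BIJ88Close231RegularTorusCwt (isBlockUnion_cubeFamB mulOp_sandwich_mulVec_apply norm_conj_toC_mul)

/-- **(2.31) FOR THE REGION `Ω`, OPERATOR FORM, ON THE WHOLE GAUGE ORBIT OF A BACKGROUND (2.23)-REGULAR ON `Ω`** — the form in which [I] §4.5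
meets the small-field region (`u = (e^{ieεA})^h` after an axial gauge fixing): for every gauge transformation `h`, the bound of
`opClose231_regular_region_cwt` holds VERBATIM for `u = (e^{ieεA})^h` (same `s₀, c₀, e₁`, same data) — `G_{k,loc}(u^h) = M_hG_{k,loc}(u)M_hᴴ`
(p31's `gLocT_gaugeAct`; the hulls are `k`-block unions), `G_k(Ω,u^h) = M_hG_k(Ω,u)M_hᴴ` (`gBox_gaugeAct`; a union of big blocks is a union of
`k`-blocks, r01's `isBlockUnion_of_bigBlocks`), `|h| = 1`, and the rotated source `h̄f` has the size and support of `f` — r18 gen 24's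
`opClose231_regular_torus_cwt_gaugeOrbit` with `T^{(0)} ↦ Ω`. [cite: BalabanImbrieJaffe1988, (2.31) p.263] [cite: BalabanImbrieJaffe1985, (6.3.2) p.320] -/
theorem opClose231_regular_region_cwt_gaugeOrbit (d L : ℕ) (hL : 2 ≤ L) {a : ℝ} (ha : 0 < a) (e creg β : ℝ) (hcreg : 0 ≤ creg)
    (hβ : 0 < β) :
    ∃ s₀ : ℕ, ∀ s : ℕ, s₀ ≤ s → ∃ c₀ e₁ : ℝ, 0 < c₀ ∧ 0 < e₁ ∧
      ∀ (P : Params) (hPd : P.d = d + 1), P.L = L → ∀ (k : ℕ), 1 ≤ k → k ≤ P.K → k + s ≤ P.m + P.K →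
      3 * (L ^ k * L ^ s) ≤ P.sitesPerDir 0 →
      ∀ (Ω : Finset (Balaban1983to89.Site P 0)),
        (∀ z z' : Balaban1983to89.Site P 0, (∀ μ, (z μ).val / (L ^ k * L ^ s) = (z' μ).val / (L ^ k * L ^ s)) → (z ∈ Ω ↔ z' ∈ Ω)) →
      ∀ (A : PBond P 0 → ℝ) (ec : ℝ), 0 < ec → ec ≤ e₁ →
      (∀ z ∈ Ω, ∀ (μ ν : Fin P.d),
          P.spacing k * |e| / ec * |A ⟨z.shift μ, ν⟩ - A ⟨z, ν⟩| ≤ creg * ec ^ (β - 1) / (L : ℝ) ^ k) →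
      ∀ (h : GaugeTransf P 0 U1) (c M0 : Fin (d + 1) → ℕ), (∀ i, c i * P.L ^ k + P.L ^ k * M0 i ≤ P.sitesPerDir 0) →
        bbHull (L ^ k * L ^ s) (cubeT hPd (P.L ^ k) c fun i => P.L ^ k * M0 i) ⊆ Ω →
      ∀ (sg W : ℕ), 1 ≤ sg → ∀ (R R₀ R₁ : ℝ), ((rowMargin L (d + 1) k s : ℕ) : ℝ) < R → 0 ≤ R₁ → R₁ < R₀ →
        2 * (sg : ℝ) / 3 + R₀ / 2 + R ≤ W → (∀ i, ((P.L ^ k * M0 i : ℕ) : ℝ) + R ≤ P.sitesPerDir 0) →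
      ∀ (x : Balaban1983to89.Site P 0), x ∈ (cubeT hPd (P.L ^ k) c fun i => P.L ^ k * M0 i) →
        (∀ i, R₀ + R ≤ (boxCoord hPd (P.L ^ k) c x i : ℝ) ∧ (boxCoord hPd (P.L ^ k) c x i : ℝ) + (R₀ + R) ≤ (P.L ^ k * M0 i : ℕ) - 1) →
      ∀ (f : Balaban1983to89.Site P 0 → ℂ) (F D : ℝ), (∀ y, ‖f y‖ ≤ F) → 0 ≤ D → (∀ y, f y ≠ 0 → D ≤ B5Ineq137Torus.T P 0 x y) →
        ‖(gLocT (B1RG242Torus.α P a k * (P.L : ℝ) ^ (k * P.d)) P.eps⁻¹ (GaugeField.gaugeAct h (expGauge P e A)) k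
              (cubeFamB hPd (P.L ^ k) c M0 sg W (L ^ k * L ^ s)) (lamFam hPd (P.L ^ k) c M0 sg)
              (cutoff R₁ R₀ (B5Ineq137Torus.T P 0)) *ᵥ f) x -
            (gBox (B1RG242Torus.α P a k * (P.L : ℝ) ^ (k * P.d)) P.eps⁻¹ (GaugeField.gaugeAct h (expGauge P e A)) k Ω *ᵥ f) x‖ ≤
          P.spacing k ^ 2 * (c₀ * (((⌊(((P.L : ℝ) ^ k) - 1 + R₀) / sg⌋₊ : ℝ) + 3) ^ (d + 1) *
              Real.exp (-(1 / (8 * (L : ℝ) ^ s) * (((P.L : ℝ) ^ k)⁻¹ * (2 * R)))) +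
                Real.exp (-(1 / (8 * (L : ℝ) ^ s) / 2 * (((P.L : ℝ) ^ k)⁻¹ * R₁)))) *
            Real.exp (-(1 / (8 * (L : ℝ) ^ s) / 2 * (((P.L : ℝ) ^ k)⁻¹ * D))) * F) := by
  obtain ⟨s₀, H0⟩ := opClose231_regular_region_cwt d L hL ha e creg β hcreg hβ
  refine ⟨s₀, fun s hs => ?_⟩
  obtain ⟨c₀, e₁, hc₀, he₁, H⟩ := H0 s hs
  refine ⟨c₀, e₁, hc₀, he₁, ?_⟩
  intro P hPd hPL k hk1 hkK hks hsize Ω hΩ A ec hec hece hreg h c M0 hfit0 hΩ₀ sg W hsg R R₀ R₁ hRm hR₁ hR10 hW hgap x hx hdeep f F D hF hD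
    hsupp
  have hk : 0 + k ≤ P.m + P.K := by omega
  have hA0 : 0 < B1RG242Torus.α P a k * (P.L : ℝ) ^ (k * P.d) :=
    mul_pos (mul_pos (B1.aSeq_pos ha (B1RG242Torus.one_lt_cast_L P) hk1) (inv_pos.mpr (pow_pos (P.spacing_pos k) 2)))
      (pow_pos P.cast_L_pos _)
  have hc' : P.eps⁻¹ ≠ 0 := inv_ne_zero P.eps_pos.ne'
  have hcube : ∀ α, IsBlockUnion k (cubeFamB hPd (P.L ^ k) c M0 sg W (L ^ k * L ^ s) α) := by
    intro α
    rw [← hPL]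
    exact isBlockUnion_cubeFamB hPd hk c M0 sg W α
  have hΩk : IsBlockUnion k Ω := by
    refine isBlockUnion_of_bigBlocks (s := s) hk fun z z' hzz' => hΩ z z' fun μ => ?_
    have h1 := hzz' μ
    rw [hPL] at h1
    exact h1
  set f' : Balaban1983to89.Site P 0 → ℂ := fun y => (starRingEnd ℂ) (toC (h y)) * f y with hf'def
  have hF' : ∀ y, ‖f' y‖ ≤ F := fun y => by rw [hf'def]; dsimp only; rw [norm_conj_toC_mul]; exact hF y
  have hsupp' : ∀ y, f' y ≠ 0 → D ≤ B5Ineq137Torus.T P 0 x y := fun y hy => hsupp y (right_ne_zero_of_mul hy)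
  have hb := H P hPd hPL k hk1 hkK hks hsize Ω hΩ A ec hec hece hreg c M0 hfit0 hΩ₀ sg W hsg R R₀ R₁ hRm hR₁ hR10 hW hgap x hx hdeep f' F D
    hF' hD hsupp'
  rw [gLocT_gaugeAct hk hc' hA0 h (expGauge P e A) hcube, gBox_gaugeAct hk hc' hA0 h (expGauge P e A) hΩk,
    mulOp_sandwich_mulVec_apply, mulOp_sandwich_mulVec_apply, ← mul_sub, norm_mul, norm_toC, one_mul]
  exact hb

end GaugeOrbit

end

end Literature.MathematicalPhysics.QuantumFieldTheory.BalabanImbrieJaffe1984to88.BIJ88Close231RegularRegionCwt
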